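import Summits.BirchSwinnertonDyer.BirchSwinnertonDyer.Theorems.ResidualThetaTransportAtTwoKatoZetaDefs
import Summits.BirchSwinnertonDyer.BirchSwinnertonDyer.Theorems.ResidualThetaTransportAtTwoResidualThetaMainConjectureAtTwoEvalK
import Literature.NumberTheory.EllipticCurves.PAdicPowerSeriesZeros
import HarnessLib

/-!
# Sketch (stub-ideation k4 g26, family 3 «assume the opposite / small cases»; director mint (194) P2 g26; events read: the v3f station texts
# of record (pen `bsd-wall-p2` g19, `KZgInteriorV3f.lean` 239fab660a0fee98), their kernel glue `Theorems/…KatoZetaGlueOfStations.lean` (LEAD g20,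
# 12:45Z: station (R) = hypothesis `hR` of `KZgGlue.iHalf_of_stations`, now a TREE statement), STUB-PLAN rev 27.5 (S138, S148, T85, H1 p719043)):
# THE DEGENERATE INSTANCES of station (R) `stub_kzgValueRelation` — `w` VAL-invisible (in particular `w = 0`, in particular the junk tuple
# `(z, c′, w, q, μt) = (0, c′, 0, 1, T)` of k1-g25 F3 / S138) — typed, kernel-reduced, and EXCLUDED: S138 («non-vacuity of child A = (VALρ) + the
# binder `IsPollackPairK….2.1`») becomes a THEOREM, modulo ONE displayed helper (H-RIG = the evaluation road's rigidity lemma, k3-g25, proved there;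
# here a corollary of (H-FIN)); plus the EVALUATED VALUE FORMULA `S_w(ψ)·g(ψ) = q·P(ζ_ψ−1)·(μt·L^±)(ζ_ψ−1)` and its consequence «a valued class is
# VAL-visible at EVERY level N ≥ N₀» (mod (H-FIN)) — the quantitative non-vanishing the (R) supplier's unit / `ν ≠ 0` step consumes.

Crux `ResidualThetaCountLowerPureAtTwo` (stmt-BirchSwinnertonDyer-26074), stub `stub_cmLambdaLower` = RSL_g (stmt-BirchSwinnertonDyer-22608; text
verbatim in `Lines/bt26_lambda.lean` v7, never re-typed here). THEOREMS ONLY: no `sorry`, no `def`, no `instance`, no notation, no new axiom.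
HONESTY: BSD is proved for no curve by any of this; 22608 / 26074 stay OPEN, 24105 (S3″) and its children A / B stay on HOLD; nothing here asserts
(E), (DESC), (R), child A or child B; station (R) is obtained below ONLY on the slice where its guard is never met.

OPPOSITE UNDER THE KNIFE. Station (R) (v3f `text_R` = `hR` of the landed `KZgGlue.iHalf_of_stations`) quantifies over ALL `z : 𝐇¹` and ALL value
vectors `w`; its guard is child A's predicate `π.KatoValuedClass g ι Ω Φ τ z c' w q μt` (p714847). The would-be counterexamples are the tuples where
the guard's Galois sums carry no information:
* §0  cyclotomic lemmas at `p = 2`, all PROVED: 2-power order of characters mod `2^{K+1}`; `((−1)^{N/2+1} ω⁻_N)(ζ − 1) ≠ 0` for `ζ` of exact order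
      `2^N`, `N` even (`eval₂_signedOmegaMinus_ne_zero`), `… ω⁺_N …` for `N` odd (`eval₂_signedOmegaPlus_ne_zero`); the tree's
      `eval₂_map_mazurTateElementK_eq_sum` read at `p = 2` (`γ₀ = 5`, `e₀ = 2`); `isPrimitiveRoot_apply_five` (`ψ(5)` has exact order `2^N`); and
      **(H-CHAR) `exists_even_primitive_apply_five_eq`: every primitive `2^N`-th root `ζ ∈ ℂ₂` (`N ≥ 1`) is `ψ(5)` for an EVEN PRIMITIVE
      `ℚ̄₂`-valued `ψ` mod `2^{N+2}`** — the `ψ ↔ ζ` supply that (VALρ) (indexed by `ψ`) needs before ANY evaluation-road statement (indexed by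
      primitive `ζ`, S148 (iii)) can consume it (57 lines; `orderOf_apply_cyclotomicGenerator` + `conductor_pow_dvd` both ways).
* §A  the four predicates EVALUATE at `(z, w) = (0, 0)` (pure unfolding): `(BKρ)` holds outright (`katoBKCoord_zero`), `(VALρ)` becomes
      `∀ m ψ, q · μt(ψ(5) − 1) · Λ_g(ψ) = 0 in ℂ₂` (`katoValCoord_zero_iff`), `(TRIVρ)` becomes `(3/2) q μt(0) ι[0]⁺ = 0` (`katoTrivCoord_zero_iff`).
* §A′ GUARD AUDIT on the final bytes: dropping `μt ≠ 0` (resp. `q ≠ 0`) the zero tuple satisfies (BKρ) ∧ (VALρ) ∧ (TRIVρ) for every `q` (resp. every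
      `μt`) — both guards are load-bearing (`unguarded_zero_tuple_mu`, `unguarded_zero_tuple_q`).
* §B  the conclusion of (R) at `z = 0` is FALSE for every `e` (`no_relation_at_zero`) and its line hypothesis automatic (`lin_at_zero`), so — given
      ONE semilinear `e` (station (E)) — `(R)|_{z=0,w=0}` ⟺ `(R₀) : ∀ c' q μt, ¬ KatoValuedClass … 0 c' 0 q μt` (`stationR_at_zero_iff`) and
      `(R)|_{z=0}` ⟺ `(R₀′) : ∀ c' w q μt, ¬ KatoValuedClass … 0 c' w q μt` (`stationR_at_zero_iff_all`), and — given the GLOBAL (E) of S153 —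
      `(R)|_{ker 𝒸}` ⟺ `(R₀″)` «no valued class with `𝒸 z = 0`» (`stationR_on_ker_cvec_iff`, `no_relation_of_cvec_eq_zero`): (R₀)/(R₀′)/(R₀″) are
      NECESSARY rungs of `stub_kzgValueRelation` — the degenerate branch of the (R) port IS an exclusion statement.
* §C₀ **THE EVALUATED VALUE FORMULA (PROVED, sign-agnostic)**: under `θ_N^ι ≡ P·L (mod ω_N)` (`P = ±ω^±_N`, `L = L^±`) and (VALρ), for every even
      primitive `ψ` of conductor `2^{N+2}`, `N ≥ 1`: `S_w(ψ) · g(ψ) = q · P(ζ_ψ − 1) · (μt · L)(ζ_ψ − 1)` in `ℂ₂` (`twistedSum_mul_gaussSum_eq`;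
      `S_w(ψ)` = the twisted Galois sum of the value vector, `ζ_ψ = ψ(5)`); hence the ENGINE `S_w(ψ) = 0 ⟹ (μt·L)(ζ_ψ−1) = 0`
      (`tsum_coeff_mul_eq_zero_of_twistedSum_eq_zero`, needs `q ≠ 0`, `P(ζ_ψ−1) ≠ 0`) and its CONVERSE given `g(ψ) ≠ 0`
      (`twistedSum_eq_zero_of_tsum_coeff_mul_eq_zero`): the VAL-visible zero locus of a valued class is EXACTLY the cyclotomic zero set of `μt · L^±`.
* §C  **(R₀⁺) PROVED** (`not_katoValuedClass_of_valInvisible`): with `L⁻ ≠ 0` and the EVEN Pollack congruences (= `IsPollackPairK….2.1 / .2.2.2`),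
      no tuple whose `w` is VAL-INVISIBLE at the even levels (all twisted Galois sums `Σ_j bO_j Σ_b ψ⁻¹(b) τ_b • w_{m+2,j}` vanish) is a Kato valued
      class — any `z`, any `μt`; corollaries `not_katoValuedClass_w_zero`, the WILDNESS of a valued class's value vector
      (`exists_twistedSum_ne_zero_of_katoValuedClass`), and station (R) on the slice `w = 0` (`stationR_at_w_zero`, vacuous). ONE helper is
      displayed as a hypothesis: (H-RIG) «`G ∈ Λ_𝒪` vanishing at `ζ − 1` for all primitive `ζ` of order `2^{ℓ_i+1}` along an unbounded `ℓ` is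
      `0`» = k3-g25 `eq_zero_of_forall_primitive_tsum_eq_zero` (`[FiniteDimensional ℚ_[2] (padicCoeffField S)]`, Weierstrass division; proved in
      `Sketch_sidea_k3_g25.lean` §2, port owed with the (R) prover per S148 (iv)). MECHANISM: VAL at `ψ_ζ` gives `μt(ζ−1) · Λ_g(ψ_ζ) = 0`; the even
      congruence evaluated (`IsCongrModOmegaO.eval₂_eq_mul`) gives `Λ_g(ψ_ζ) = ±ω⁻_N(ζ−1) · L⁻(ζ−1)` with `ω⁻_N(ζ−1) ≠ 0`; so `(μt · L⁻)(ζ−1) = 0`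
      at every primitive `ζ` of order `2^N`, all even `N ≥ 2`; rigidity forces `μt · L⁻ = 0`: absurd. No Rohrlich, no Kato, no CM, no (E)/(BKρ).
* §D  the same in the v3f currency `S = range ι`, hypotheses read off RSL_g's binder `IsPollackPairK g ι Ω Lp Lm`
      (`not_katoValuedClass_w_zero_of_isPollackPairK`, `stationR_at_w_zero_of_isPollackPairK`).
* §E  **QUANTITATIVE WILDNESS (PROVED mod (H-FIN))**: `hRIG_of_hFIN` ((H-FIN) «a nonzero `G ∈ Λ_𝒪` has no zero `ζ − 1`, `ζ` of exact order `2^N`,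
      for `N ≥ N₀(G)`» ⟹ (H-RIG)), and `eventually_twistedSum_ne_zero_of_katoValuedClass` / `…_of_isPollackPairK`: with the FULL binder
      `IsPollackPairK g ι Ω Lp Lm` (odd levels via `ω⁺/L⁺`, even via `ω⁻/L⁻`) the value vector of ANY Kato valued class has `S_w(ψ) ≠ 0` at EVERY
      even primitive `ψ` of conductor `2^{N+2}`, all `N ≥ N₀(μt, L⁺, L⁻)` — the value-side non-vanishing that the (R) supplier's unit step
      (w3 g18 F3, `m ≥ m₀`) and `stub_kzgValueRelation`'s `ν ≠ 0` consume. (H-FIN) is the ONE displayed helper of §C–§E (Weierstrass preparation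
      over `𝒪⟦T⟧`; tree pattern `MemIwasawaRat.finite_setOf_hasSum_zero` for `ℤ_p`; k3-g25's (H-RIG) is its corollary here).

References: [Kato2004Asterisque] Thm. 12.5 (1) (pp. 221–222), §15.16 (p. 265); [Pollack2003] Cor. 5.11, Prop. 6.9, Prop. 6.18 (proofs);
[Washington1997] §7.1 Thm. 7.3, Prop. 7.2, §7.2; [MazurTateTeitelbaum1986Invent] §I.13.
-/

set_option autoImplicit false
set_option linter.dupNamespace false
set_option linter.unusedSectionVars false
set_option linter.unusedVariables false
set_option backward.isDefEq.respectTransparency false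

noncomputable section

open scoped Classical NumberField

open Polynomial
open Literature.NumberTheory.EllipticCurves Literature.NumberTheory.EllipticCurves.GreenbergSelmer
open Literature.NumberTheory.EllipticCurves.ModularForms
open Literature.NumberTheory.GaloisRepresentations NumberField IsDedekindDomain Field
open GreenbergVatsal2000 Kobayashi2003 Rat.HeightOneSpectrum
open Summit.BirchSwinnertonDyer.Rank1Residual.Additive Summit.BirchSwinnertonDyer.Rank1Residual.Additive.PadicCyclotomicTower
open Summit.BirchSwinnertonDyer.BirchSwinnertonDyer.Theorems.OnePair
open Summit.BirchSwinnertonDyer.BirchSwinnertonDyer.Theorems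

namespace Summit.BirchSwinnertonDyer.BirchSwinnertonDyer.Cruxes.ResidualThetaCountLowerPureAtTwo.SideaK4G26

/-! ## §0 Cyclotomic lemmas at `p = 2` (no pins) -/

/-- A Dirichlet character modulo `2^(K+1)` has `2`-power order (the unit group `(ℤ/2^{K+1})ˣ` has order `2^K`). [folklore] -/
theorem exists_orderOf_eq_two_pow {R : Type*} [CommRing R] [IsDomain R] (K : ℕ)
    (χ : DirichletCharacter R (2 ^ (K + 1))) : ∃ j : ℕ, orderOf χ = 2 ^ j := by
  classical
  haveI : NeZero (2 ^ (K + 1)) := ⟨pow_ne_zero _ two_ne_zero⟩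
  have h1 : χ ^ Fintype.card (ZMod (2 ^ (K + 1)))ˣ = 1 := by
    apply MulChar.ext
    intro a
    rw [MulChar.pow_apply_coe, ← map_pow, ← Units.val_pow_eq_pow_val, pow_card_eq_one, Units.val_one, map_one,
      MulChar.one_apply_coe]
  have hdvd := orderOf_dvd_of_pow_eq_one h1
  rw [ZMod.card_units_eq_totient, Nat.totient_prime_pow_succ Nat.prime_two] at hdvd
  norm_num at hdvd
  obtain ⟨j, -, hj⟩ := (Nat.dvd_prime_pow Nat.prime_two).mp hdvd
  exact ⟨j, hj⟩

/-- **`((−1)^{N/2+1} ω⁻_N)(ζ − 1) ≠ 0` for `ζ ∈ ℂ₂` of exact order `2^N`, `N` even**: the roots of `ω⁻_N(T) = ∏_{odd j ≤ N} Φ_{2^j}(1+T)`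
are the `ζ' − 1` with `ζ'` of exact order `2^j`, `j` odd. [cite: Pollack2003, §6.5 (display before Prop. 6.18)] -/
theorem eval₂_signedOmegaMinus_ne_zero {N : ℕ} (hN : Even N) {ζ : ℂ_[2]} (hζ : IsPrimitiveRoot ζ (2 ^ N)) :
    (((-1 : ℤ[X]) ^ (N / 2 + 1) * cyclotomicOmegaMinus 2 N).map (Int.castRingHom (PadicAlgCl 2))).eval₂
        (algebraMap (PadicAlgCl 2) ℂ_[2]) (ζ - 1) ≠ 0 := by
  classical
  rw [eval₂_map, eval₂_mul, eval₂_pow, eval₂_neg, eval₂_one, cyclotomicOmegaMinus, eval₂_finsetProd]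
  refine mul_ne_zero (pow_ne_zero _ (neg_ne_zero.mpr one_ne_zero)) ?_
  rw [Finset.prod_ne_zero_iff]
  intro k hk h0
  rw [eval₂_comp, eval₂_add, eval₂_X, eval₂_one, sub_add_cancel, eval₂_eq_eval_map, map_cyclotomic] at h0
  haveI : NeZero ((2 ^ (2 * k - 1) : ℕ) : ℂ_[2]) := ⟨by exact_mod_cast pow_ne_zero _ two_ne_zero⟩
  have hprim : IsPrimitiveRoot ζ (2 ^ (2 * k - 1)) := (isRoot_cyclotomic_iff).mp h0
  have heq : 2 ^ (2 * k - 1) = 2 ^ N := hprim.unique hζ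
  have hk' : 2 * k - 1 = N := Nat.pow_right_injective le_rfl heq
  rw [Finset.mem_Icc] at hk
  obtain ⟨r, hr⟩ := hN
  omega

/-- **`((−1)^{N/2+1} ω⁺_N)(ζ − 1) ≠ 0` for `ζ ∈ ℂ₂` of exact order `2^N`, `N` odd**: the roots of `ω⁺_N(T) = ∏_{even j ≤ N} Φ_{2^j}(1+T)` are
the `ζ' − 1` with `ζ'` of exact order `2^j`, `j` even. [cite: Pollack2003, §6.5 (display before Prop. 6.18)] -/
theorem eval₂_signedOmegaPlus_ne_zero {N : ℕ} (hN : Odd N) {ζ : ℂ_[2]} (hζ : IsPrimitiveRoot ζ (2 ^ N)) :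
    (((-1 : ℤ[X]) ^ (N / 2 + 1) * cyclotomicOmegaPlus 2 N).map (Int.castRingHom (PadicAlgCl 2))).eval₂
        (algebraMap (PadicAlgCl 2) ℂ_[2]) (ζ - 1) ≠ 0 := by
  classical
  rw [eval₂_map, eval₂_mul, eval₂_pow, eval₂_neg, eval₂_one, cyclotomicOmegaPlus, eval₂_finsetProd]
  refine mul_ne_zero (pow_ne_zero _ (neg_ne_zero.mpr one_ne_zero)) ?_
  rw [Finset.prod_ne_zero_iff]
  intro k hk h0
  rw [eval₂_comp, eval₂_add, eval₂_X, eval₂_one, sub_add_cancel, eval₂_eq_eval_map, map_cyclotomic] at h0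
  haveI : NeZero ((2 ^ (2 * k) : ℕ) : ℂ_[2]) := ⟨by exact_mod_cast pow_ne_zero _ two_ne_zero⟩
  have hprim : IsPrimitiveRoot ζ (2 ^ (2 * k)) := (isRoot_cyclotomic_iff).mp h0
  have heq : 2 ^ (2 * k) = 2 ^ N := hprim.unique hζ
  have hk' : 2 * k = N := Nat.pow_right_injective le_rfl heq
  rw [Finset.mem_Icc] at hk
  obtain ⟨r, hr⟩ := hN
  omega

variable {M : ℕ} [NeZero M] (g : CuspForm (CongruenceSubgroup.Gamma0 M) 2) (ι : coeffField g →+* PadicAlgCl 2) (Ω : ℂ)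

/-- **The tree's evaluation lemma `eval₂_map_mazurTateElementK_eq_sum` read at `p = 2`** (`e₀ = 2`, `γ₀ = 5`):
`θ_N(g;Ω)^ι(χ(5) − 1) = Σ_{a mod 2^{N+2}} χ(a) ι[a/2^{N+2}]⁺_{g,Ω}` for an even `ℂ₂`-valued `χ` mod `2^{N+2}`. [cite: Pollack2003, Prop. 6.9 (proof)] -/
theorem eval₂_map_mazurTateElementK_two {N : ℕ} (χ : DirichletCharacter ℂ_[2] (2 ^ (N + 2))) (heven : χ.Even) :
    ((mazurTateElementK g Ω 2 N).map ι).eval₂ (algebraMap (PadicAlgCl 2) ℂ_[2]) (χ (5 : ZMod (2 ^ (N + 2))) - 1) =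
      ∑ a : ZMod (2 ^ (N + 2)), χ a * algebraMap (PadicAlgCl 2) ℂ_[2] (ι (plusSymbolK g Ω ((a.val : ℚ) / (2 : ℚ) ^ (N + 2)))) := by
  have h := ResidualThetaLayer.eval₂_map_mazurTateElementK_eq_sum (p := 2) g ι Ω (n := N) χ heven
    (exists_orderOf_eq_two_pow (N + 1) χ)
  have h5 : ((cyclotomicGenerator 2 : ℕ) : ZMod (2 ^ (N + cyclotomicExponent 2))) = (5 : ZMod (2 ^ (N + 2))) := by
    show ((1 + 2 ^ 2 : ℕ) : ZMod (2 ^ (N + 2))) = 5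
    norm_num
  rw [h5] at h
  simpa [cyclotomicExponent] using h

/-! ## The pin bundle -/

variable {S : Set (PadicAlgCl 2)} {W : WeierstrassCurve ℚ} [W.IsElliptic] {κ : ZpExtension ℚ 2} {γ : absoluteGaloisGroup ℚ}
  {S₀ : Finset (HeightOneSpectrum (𝓞 ℚ))} {n : ℕ} {ρ : FramedGaloisRep ℚ ↥(padicCoeffIntegers S) 2}
  {Θ : ∀ v : HeightOneSpectrum (𝓞 ℚ), ((2 : ℕ) : 𝓞 ℚ) ∈ v.asIdeal → (Cofree ρ ↥(padicCoeffField S) ≃+ (Fin n → ↥(W.geomPrimaryTorsion 2)))}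
  {hΘ : ∀ v hv (δ : absoluteGaloisGroup (v.adicCompletion ℚ)) m i,
    Θ v hv (resGalOfEmb (closureEmb (K := ℚ) (v.adicCompletion ℚ)) δ • m) i = resGalOfEmb (closureEmb (K := ℚ) (v.adicCompletion ℚ)) δ • Θ v hv m i}
  {I : Kato2004.IwasawaH1DataCoeff (FramedGaloisRep.toGaloisRep ρ) 2 κ γ}
  {Sg : AddSubgroup (subgroupH1 κ.kerSubgroup (Cofree ρ ↥(padicCoeffField S)))} [Module ↥(padicCoeffIntegers S) ↥Sg]
  (π : OnePairPins S W κ γ S₀ n ρ Θ hΘ I Sg)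

/-- **(H-CHAR, PROVED) every primitive `2^N`-th root of unity `ζ ∈ ℂ₂` (`N ≥ 1`) is `ψ(5)` for an EVEN PRIMITIVE `ℚ̄₂`-valued
Dirichlet character `ψ` modulo `2^{N+2}`.** Take a primitive even `ψ₁` of `2`-power order (`exists_isPrimitive_even_orderOf_eq_prime_pow`);
`ψ₁(5)` has exact order `2^N` (`orderOf_apply_cyclotomicGenerator`, read in `ℂ₂`), so `ζ = ψ₁(5)^i` with `i` odd, and `ψ = ψ₁^i` is even,
takes the value `ζ` at `5`, and is primitive because `ψ₁` is a power of it (`conductor_pow_dvd` both ways).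
[cite: Washington1997, §7.2] [cite: MazurTateTeitelbaum1986Invent, §I.13] -/
theorem exists_even_primitive_apply_five_eq (N : ℕ) (ζ : ℂ_[2]) (hN : 1 ≤ N) (hζ : IsPrimitiveRoot ζ (2 ^ N)) :
    ∃ ψ : DirichletCharacter (PadicAlgCl 2) (2 ^ (N + 2)), ψ (-1) = 1 ∧ ψ.IsPrimitive ∧
      algebraMap (PadicAlgCl 2) ℂ_[2] (ψ (5 : ZMod (2 ^ (N + 2)))) = ζ := by
  classical
  obtain ⟨n, rfl⟩ : ∃ n, N = n + 1 := ⟨N - 1, by omega⟩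
  show ∃ ψ : DirichletCharacter (PadicAlgCl 2) (2 ^ (n + 3)), ψ (-1) = 1 ∧ ψ.IsPrimitive ∧
      algebraMap (PadicAlgCl 2) ℂ_[2] (ψ (5 : ZMod (2 ^ (n + 3)))) = ζ
  haveI : NeZero ((Nat.totient (2 ^ (n + 3)) : ℕ) : PadicAlgCl 2) :=
    ⟨Nat.cast_ne_zero.mpr (Nat.totient_pos.mpr (pow_pos two_pos _)).ne'⟩
  haveI : NeZero (2 ^ (n + 3)) := ⟨pow_ne_zero _ two_ne_zero⟩
  haveI : NeZero (2 ^ (n + 1)) := ⟨pow_ne_zero _ two_ne_zero⟩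
  obtain ⟨ψ₁, hψ₁p, hψ₁e, j, hj⟩ := exists_isPrimitive_even_orderOf_eq_prime_pow (PadicAlgCl 2) (p := 2) n
  set g₂ : PadicAlgCl 2 →+* ℂ_[2] := algebraMap (PadicAlgCl 2) ℂ_[2] with hg₂
  set χ₁ : DirichletCharacter ℂ_[2] (2 ^ (n + 3)) := ψ₁.ringHomComp g₂ with hχ₁
  have hχ₁p : χ₁.IsPrimitive := (isPrimitive_ringHomComp_iff g₂ ψ₁).mpr hψ₁p
  have hχ₁e : χ₁.Even := (even_ringHomComp_iff g₂ ψ₁).mpr hψ₁e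
  have hχ₁o : ∃ j : ℕ, orderOf χ₁ = 2 ^ j := ⟨j, by rw [hχ₁, orderOf_ringHomComp, hj]⟩
  have hce : cyclotomicExponent 2 = 2 := by rw [cyclotomicExponent, if_pos rfl]
  have h5 : ((cyclotomicGenerator 2 : ℕ) : ZMod (2 ^ (n + 3))) = (5 : ZMod (2 ^ (n + 3))) := by
    show ((1 + 2 ^ cyclotomicExponent 2 : ℕ) : ZMod (2 ^ (n + 3))) = 5
    rw [hce]; norm_num
  have hord : orderOf (χ₁ (5 : ZMod (2 ^ (n + 3)))) = 2 ^ (n + 1) := by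
    have h1 := orderOf_apply_cyclotomicGenerator (p := 2) (m := n + 3) (by rw [hce]; omega) χ₁ hχ₁p hχ₁e hχ₁o
    rwa [h5, hce, show n + 3 - 2 = n + 1 by omega] at h1
  have hval : χ₁ (5 : ZMod (2 ^ (n + 3))) = g₂ (ψ₁ (5 : ZMod (2 ^ (n + 3)))) := by
    rw [hχ₁, MulChar.ringHomComp_apply]
  have hη : IsPrimitiveRoot (g₂ (ψ₁ (5 : ZMod (2 ^ (n + 3))))) (2 ^ (n + 1)) := by
    rw [← hval, ← hord]
    exact IsPrimitiveRoot.orderOf _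
  obtain ⟨i, -, hi⟩ := hη.eq_pow_of_pow_eq_one hζ.pow_eq_one
  have hic : i.Coprime (2 ^ (n + 1)) := (hη.pow_iff_coprime (pow_pos two_pos _) i).mp (by rw [hi]; exact hζ)
  have hi2 : i.Coprime 2 := (Nat.coprime_pow_right_iff (by omega) i 2).mp hic
  have hio : i.Coprime (orderOf ψ₁) := by rw [hj]; exact hi2.pow_right j
  obtain ⟨b, hb⟩ := exists_pow_eq_self_of_coprime hio
  obtain ⟨u5, hu5⟩ := isUnit_cyclotomicGenerator_cast (p := 2) (n + 3)
  refine ⟨ψ₁ ^ i, ?_, ?_, ?_⟩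
  · rw [← Units.coe_neg_one, MulChar.pow_apply_coe, Units.coe_neg_one, hψ₁e, one_pow]
  · rw [DirichletCharacter.isPrimitive_def] at hψ₁p ⊢
    refine Nat.dvd_antisymm ?_ ?_
    · have h := DirichletCharacter.conductor_pow_dvd ψ₁ i
      rwa [hψ₁p] at h
    · have h := DirichletCharacter.conductor_pow_dvd (ψ₁ ^ i) b
      rwa [hb, hψ₁p] at h
  · rw [← h5, ← hu5, MulChar.pow_apply_coe, map_pow, hu5, h5, hi]

/-- **`ψ(5)` has exact order `2^N` (read in `ℂ₂`) for an even primitive `ℚ̄₂`-valued `ψ` mod `2^{N+2}`, `N ≥ 1`** — the INTO direction of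
(H-CHAR) (`orderOf_apply_cyclotomicGenerator`; k2-g28 files the same adapter independently as `SideaK2G28.isPrimitiveRoot_apply_five`).
[cite: Washington1997, §7.2] [cite: MazurTateTeitelbaum1986Invent, §I.13] -/
theorem isPrimitiveRoot_apply_five {N : ℕ} (hN : 1 ≤ N) (ψ : DirichletCharacter (PadicAlgCl 2) (2 ^ (N + 2)))
    (hψe : ψ (-1) = 1) (hψp : ψ.IsPrimitive) :
    IsPrimitiveRoot (algebraMap (PadicAlgCl 2) ℂ_[2] (ψ (5 : ZMod (2 ^ (N + 2))))) (2 ^ N) := by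
  classical
  haveI : NeZero (2 ^ (N + 2)) := ⟨pow_ne_zero _ two_ne_zero⟩
  set g₂ : PadicAlgCl 2 →+* ℂ_[2] := algebraMap (PadicAlgCl 2) ℂ_[2] with hg₂
  set χ : DirichletCharacter ℂ_[2] (2 ^ (N + 2)) := ψ.ringHomComp g₂ with hχ
  have hχp : χ.IsPrimitive := (isPrimitive_ringHomComp_iff g₂ ψ).mpr hψp
  have hχe : χ.Even := (even_ringHomComp_iff g₂ ψ).mpr (show ψ.Even from hψe)
  have hχo : ∃ j : ℕ, orderOf χ = 2 ^ j := exists_orderOf_eq_two_pow (N + 1) χ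
  have hce : cyclotomicExponent 2 = 2 := by rw [cyclotomicExponent, if_pos rfl]
  have h5 : ((cyclotomicGenerator 2 : ℕ) : ZMod (2 ^ (N + 2))) = (5 : ZMod (2 ^ (N + 2))) := by
    show ((1 + 2 ^ cyclotomicExponent 2 : ℕ) : ZMod (2 ^ (N + 2))) = 5
    rw [hce]; norm_num
  have hord : orderOf (χ (5 : ZMod (2 ^ (N + 2)))) = 2 ^ N := by
    have h1 := orderOf_apply_cyclotomicGenerator (p := 2) (m := N + 2) (by rw [hce]; omega) χ hχp hχe hχo
    rwa [h5, hce, show N + 2 - 2 = N by omega] at h1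
  have hval : χ (5 : ZMod (2 ^ (N + 2))) = g₂ (ψ (5 : ZMod (2 ^ (N + 2)))) := by
    rw [hχ, MulChar.ringHomComp_apply]
  rw [← hval, ← hord]
  exact IsPrimitiveRoot.orderOf _

/-! ## §A The valued-class predicates at the zero tuple `z := 0`, `w := 0` (pure unfolding) -/

/-- `𝒸 0 = 0` (the Coleman coordinates are additive in the class). [cite: Kobayashi2003, Thm. 6.2 (p. 18)] -/
theorem cvec_zero : π.cvec 0 = 0 := by
  funext i
  rw [OnePairPins.cvec_apply, map_zero, AddMonoidHom.zero_comp, map_zero, Pi.zero_apply]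

/-- **(BKρ) holds at the zero tuple**: both sides of the layer-pairing identity vanish for `z = 0`, `w = 0`.
[cite: BlochKato1990, §3 (3.10.1), (3.11)] [cite: Kato2004Asterisque, Thm. 12.5 (1) (pp. 221–222)] -/
theorem katoBKCoord_zero [W.IsGloballyMinimal]
    (Φ : AlgebraicClosure ℚ_[2] ≃ₐ[ℚ] AlgebraicClosure (π.v.adicCompletion ℚ))
    (τ : ∀ m : ℕ, ZMod (2 ^ m) → Field.absoluteGaloisGroup ℚ_[2]) (c' : Fin n → ↥(padicCoeffIntegers S)) :
    π.KatoBKCoord Φ τ 0 c' 0 := by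
  intro a m i Q₀ hQv hker
  simp only [smul_zero, map_zero, AddMonoidHom.zero_apply, Pi.zero_apply, mul_zero, Finset.sum_const_zero,
    PadicInt.coe_zero]

/-- **(VALρ) at `w = 0` reads `q · μt(ψ(5) − 1) · Λ_g(ψ) = 0` for every even primitive `ψ` mod `2^{m+2}`** (the value side vanishes).
[cite: Kato2004Asterisque, Thm. 12.5 (1) (pp. 221–222), §15.16 (p. 265)] -/
theorem katoValCoord_zero_iff (τ : ∀ m : ℕ, ZMod (2 ^ m) → Field.absoluteGaloisGroup ℚ_[2]) (q : PadicAlgCl 2) (μt : IwasawaAlgebraO S) :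
    π.KatoValCoord g ι Ω τ 0 q μt ↔
      ∀ (m : ℕ) (ψ : DirichletCharacter (PadicAlgCl 2) (2 ^ (m + 2))), ψ (-1) = 1 → ψ.IsPrimitive →
        algebraMap (PadicAlgCl 2) ℂ_[2] q *
            (∑' k, algebraMap (PadicAlgCl 2) ℂ_[2] ((PowerSeries.coeff k μt : ↥(padicCoeffIntegers S)) : PadicAlgCl 2) *
              (algebraMap (PadicAlgCl 2) ℂ_[2] (ψ (5 : ZMod (2 ^ (m + 2)))) - 1) ^ k) *
          algebraMap (PadicAlgCl 2) ℂ_[2] (∑ a : ZMod (2 ^ (m + 2)), ψ a * ι (plusSymbolK g Ω ((a.val : ℚ) / (2 : ℚ) ^ (m + 2)))) = 0 := by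
  refine forall_congr' fun m ↦ forall_congr' fun ψ ↦ forall_congr' fun _ ↦ forall_congr' fun _ ↦ ?_
  simp only [Pi.zero_apply, smul_zero, mul_zero, Finset.sum_const_zero, zero_mul, map_zero]
  exact eq_comm

/-- **(TRIVρ) at `w = 0` reads `(3/2) · q · μt(0) · ι[0]⁺_{g,Ω} = 0`** (the trace side vanishes; levels `4` and `8` give the same condition).
[cite: Kato2004Asterisque, Thm. 12.5 (1) (pp. 221–222)] -/
theorem katoTrivCoord_zero_iff (τ : ∀ m : ℕ, ZMod (2 ^ m) → Field.absoluteGaloisGroup ℚ_[2]) (q : PadicAlgCl 2) (μt : IwasawaAlgebraO S) :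
    π.KatoTrivCoord g ι Ω τ 0 q μt ↔
      (3 / 2 : PadicAlgCl 2) * q * ((PowerSeries.coeff 0 μt : ↥(padicCoeffIntegers S)) : PadicAlgCl 2) * ι (plusSymbolK g Ω 0) = 0 := by
  constructor
  · intro h
    have h2 := h 2 le_rfl (by norm_num)
    simp only [Pi.zero_apply, smul_zero, mul_zero, Finset.sum_const_zero] at h2
    exact h2.symm
  · intro h k _ _
    simp only [Pi.zero_apply, smul_zero, mul_zero, Finset.sum_const_zero]
    exact h.symm

/-- **The valued class at the zero tuple, unfolded.** [cite: Kato2004Asterisque, Thm. 12.5 (1) (pp. 221–222), §15.16 (p. 265)] -/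
theorem katoValuedClass_zero_iff [W.IsGloballyMinimal]
    (Φ : AlgebraicClosure ℚ_[2] ≃ₐ[ℚ] AlgebraicClosure (π.v.adicCompletion ℚ))
    (τ : ∀ m : ℕ, ZMod (2 ^ m) → Field.absoluteGaloisGroup ℚ_[2]) (c' : Fin n → ↥(padicCoeffIntegers S))
    (q : PadicAlgCl 2) (μt : IwasawaAlgebraO S) :
    π.KatoValuedClass g ι Ω Φ τ 0 c' 0 q μt ↔
      q ≠ 0 ∧ μt ≠ 0 ∧ π.CoordNondeg c' ∧
        (∀ (m : ℕ) (ψ : DirichletCharacter (PadicAlgCl 2) (2 ^ (m + 2))), ψ (-1) = 1 → ψ.IsPrimitive →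
          algebraMap (PadicAlgCl 2) ℂ_[2] q *
              (∑' k, algebraMap (PadicAlgCl 2) ℂ_[2] ((PowerSeries.coeff k μt : ↥(padicCoeffIntegers S)) : PadicAlgCl 2) *
                (algebraMap (PadicAlgCl 2) ℂ_[2] (ψ (5 : ZMod (2 ^ (m + 2)))) - 1) ^ k) *
            algebraMap (PadicAlgCl 2) ℂ_[2] (∑ a : ZMod (2 ^ (m + 2)), ψ a * ι (plusSymbolK g Ω ((a.val : ℚ) / (2 : ℚ) ^ (m + 2)))) = 0) ∧
        (3 / 2 : PadicAlgCl 2) * q * ((PowerSeries.coeff 0 μt : ↥(padicCoeffIntegers S)) : PadicAlgCl 2) * ι (plusSymbolK g Ω 0) = 0 := by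
  unfold OnePairPins.KatoValuedClass
  rw [katoValCoord_zero_iff, katoTrivCoord_zero_iff]
  exact ⟨fun ⟨h1, h2, h3, _, h5, h6⟩ ↦ ⟨h1, h2, h3, h5, h6⟩,
    fun ⟨h1, h2, h3, h5, h6⟩ ↦ ⟨h1, h2, h3, katoBKCoord_zero π Φ τ c', h5, h6⟩⟩

/-! ## §B Station (R) at `z = 0`: the conclusion is false, the line hypothesis automatic — `(R)|_{z=0,w=0} ⟺ (R₀)` -/

/-- **The line hypothesis of (R) is automatic at `z = 0`** (`Λ_𝒪 · 0 = 0`). [cite: Kato2004Asterisque, Thm. 12.5 (2) (p. 222)] -/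
theorem lin_at_zero (e : (Fin n → PowerSeries ℤ_[2]) ≃+ IwasawaAlgebraO S) :
    ∀ (s : IwasawaAlgebraO S) (x : I.H), x ∈ Submodule.span (IwasawaAlgebraO S) ({(0 : I.H)} : Set I.H) →
      e (π.cvec (s • x)) = s * e (π.cvec x) := by
  intro s x hx
  rw [Submodule.span_zero_singleton, Submodule.mem_bot] at hx
  subst hx
  rw [smul_zero, cvec_zero, map_zero, mul_zero]

/-- **The conclusion of (R) fails at `z = 0`** for every additive `e` once `μt ≠ 0` and `L⁻ ≠ 0`: `C ν · e 𝒸 0 = 0 ≠ μt · L⁻ · u` (`u ≠ 0`;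
`Λ_𝒪` is a domain). [cite: Pollack2003, Cor. 5.11 (shape)] -/
theorem no_relation_at_zero (e : (Fin n → PowerSeries ℤ_[2]) ≃+ IwasawaAlgebraO S) {μt Lm : IwasawaAlgebraO S}
    (hμ : μt ≠ 0) (hLm : Lm ≠ 0) :
    ¬ ∃ (ν : ↥(padicCoeffIntegers S)) (u : IwasawaAlgebraO S), ν ≠ 0 ∧ u ≠ 0 ∧
        PowerSeries.C ν * e (π.cvec 0) = μt * (Lm * u) := by
  rintro ⟨ν, u, -, hu, h⟩
  rw [cvec_zero, map_zero, mul_zero] at h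
  exact mul_ne_zero hμ (mul_ne_zero hLm hu) h.symm

/-- **`(R)|_{z=0,w=0} ⟺ (R₀)`.** Station (R)'s instance at the zero tuple (all frames / coordinates / scalars / multipliers, every admissible
`e`) is EQUIVALENT — given ONE admissible trivialisation `e` (station (E)) and `L⁻ ≠ 0` — to «the zero tuple is never a Kato valued class».
So (R₀) is a necessary rung of `stub_kzgValueRelation`, and it is exactly the statement that child A's guards exclude `(z, w) = (0, 0)`.
[cite: Kato2004Asterisque, Thm. 12.5 (1)–(2) (pp. 221–222)] [cite: Pollack2003, Cor. 5.11] -/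
theorem stationR_at_zero_iff [W.IsGloballyMinimal]
    (Φ : AlgebraicClosure ℚ_[2] ≃ₐ[ℚ] AlgebraicClosure (π.v.adicCompletion ℚ))
    (τ : ∀ m : ℕ, ZMod (2 ^ m) → Field.absoluteGaloisGroup ℚ_[2]) {Lm : IwasawaAlgebraO S} (hLm : Lm ≠ 0)
    (hE : ∃ e : (Fin n → PowerSeries ℤ_[2]) ≃+ IwasawaAlgebraO S,
      ∀ (r : PowerSeries ℤ_[2]) (t : Fin n → PowerSeries ℤ_[2]), e (r • t) = PowerSeries.map (padicIntToCoeffIntegers S) r * e t) :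
    (∀ (c' : Fin n → ↥(padicCoeffIntegers S)) (q : PadicAlgCl 2) (μt : IwasawaAlgebraO S),
        π.KatoValuedClass g ι Ω Φ τ 0 c' 0 q μt →
        ∀ e : (Fin n → PowerSeries ℤ_[2]) ≃+ IwasawaAlgebraO S,
          (∀ (r : PowerSeries ℤ_[2]) (t : Fin n → PowerSeries ℤ_[2]), e (r • t) = PowerSeries.map (padicIntToCoeffIntegers S) r * e t) →
          (∀ (s : IwasawaAlgebraO S) (x : I.H), x ∈ Submodule.span (IwasawaAlgebraO S) ({(0 : I.H)} : Set I.H) →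
            e (π.cvec (s • x)) = s * e (π.cvec x)) →
          ∃ (ν : ↥(padicCoeffIntegers S)) (u : IwasawaAlgebraO S), ν ≠ 0 ∧ u ≠ 0 ∧
            PowerSeries.C ν * e (π.cvec 0) = μt * (Lm * u)) ↔
      ∀ (c' : Fin n → ↥(padicCoeffIntegers S)) (q : PadicAlgCl 2) (μt : IwasawaAlgebraO S),
        ¬ π.KatoValuedClass g ι Ω Φ τ 0 c' 0 q μt := by
  constructor
  · intro h c' q μt hcl
    obtain ⟨e, he⟩ := hE
    exact no_relation_at_zero π e hcl.2.1 hLm (h c' q μt hcl e he (lin_at_zero π e))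
  · intro h c' q μt hcl
    exact (h c' q μt hcl).elim

/-- **`(R)|_{z=0} ⟺ (R₀′)` for EVERY value vector `w`** (not only `w = 0`): given ONE admissible trivialisation `e` (station (E)) and `L⁻ ≠ 0`,
station (R)'s instance at `z = 0` — all `c′, w, q, μt`, every admissible `e` — is EQUIVALENT to «no tuple `(0, c′, w, q, μt)` is a Kato valued class».
§C settles (R₀′) for every VAL-invisible `w`; for VAL-visible `w` at `z = 0` it is the (BKρ)-dictionary question of the port (plan P3 of the card).
[cite: Kato2004Asterisque, Thm. 12.5 (1)–(2) (pp. 221–222)] [cite: Pollack2003, Cor. 5.11] -/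
theorem stationR_at_zero_iff_all [W.IsGloballyMinimal]
    (Φ : AlgebraicClosure ℚ_[2] ≃ₐ[ℚ] AlgebraicClosure (π.v.adicCompletion ℚ))
    (τ : ∀ m : ℕ, ZMod (2 ^ m) → Field.absoluteGaloisGroup ℚ_[2]) {Lm : IwasawaAlgebraO S} (hLm : Lm ≠ 0)
    (hE : ∃ e : (Fin n → PowerSeries ℤ_[2]) ≃+ IwasawaAlgebraO S,
      ∀ (r : PowerSeries ℤ_[2]) (t : Fin n → PowerSeries ℤ_[2]), e (r • t) = PowerSeries.map (padicIntToCoeffIntegers S) r * e t) :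
    (∀ (c' : Fin n → ↥(padicCoeffIntegers S)) (w : ℕ → Fin π.nb → PadicAlgCl 2) (q : PadicAlgCl 2) (μt : IwasawaAlgebraO S),
        π.KatoValuedClass g ι Ω Φ τ 0 c' w q μt →
        ∀ e : (Fin n → PowerSeries ℤ_[2]) ≃+ IwasawaAlgebraO S,
          (∀ (r : PowerSeries ℤ_[2]) (t : Fin n → PowerSeries ℤ_[2]), e (r • t) = PowerSeries.map (padicIntToCoeffIntegers S) r * e t) →
          (∀ (s : IwasawaAlgebraO S) (x : I.H), x ∈ Submodule.span (IwasawaAlgebraO S) ({(0 : I.H)} : Set I.H) →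
            e (π.cvec (s • x)) = s * e (π.cvec x)) →
          ∃ (ν : ↥(padicCoeffIntegers S)) (u : IwasawaAlgebraO S), ν ≠ 0 ∧ u ≠ 0 ∧
            PowerSeries.C ν * e (π.cvec 0) = μt * (Lm * u)) ↔
      ∀ (c' : Fin n → ↥(padicCoeffIntegers S)) (w : ℕ → Fin π.nb → PadicAlgCl 2) (q : PadicAlgCl 2) (μt : IwasawaAlgebraO S),
        ¬ π.KatoValuedClass g ι Ω Φ τ 0 c' w q μt := by
  constructor
  · intro h c' w q μt hcl
    obtain ⟨e, he⟩ := hE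
    exact no_relation_at_zero π e hcl.2.1 hLm (h c' w q μt hcl e he (lin_at_zero π e))
  · intro h c' w q μt hcl
    exact (h c' w q μt hcl).elim

/-- **The conclusion of (R) fails on the whole KERNEL of the Coleman coordinate map** `𝒸` (not only at `z = 0`): if `𝒸 z = 0` then
`C ν · e(𝒸 z) = 0 ≠ μt · L⁻ · u`. [cite: Kobayashi2003, Thm. 6.2 (p. 18)] [cite: Pollack2003, Cor. 5.11 (shape)] -/
theorem no_relation_of_cvec_eq_zero (e : (Fin n → PowerSeries ℤ_[2]) ≃+ IwasawaAlgebraO S) {z : I.H} (hz : π.cvec z = 0)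
    {μt Lm : IwasawaAlgebraO S} (hμ : μt ≠ 0) (hLm : Lm ≠ 0) :
    ¬ ∃ (ν : ↥(padicCoeffIntegers S)) (u : IwasawaAlgebraO S), ν ≠ 0 ∧ u ≠ 0 ∧
        PowerSeries.C ν * e (π.cvec z) = μt * (Lm * u) := by
  rintro ⟨ν, u, -, hu, h⟩
  rw [hz, map_zero, mul_zero] at h
  exact mul_ne_zero hμ (mul_ne_zero hLm hu) h.symm

/-- **`(R)|_{ker 𝒸} ⟺ (R₀″)`.** Given ONE GLOBALLY admissible trivialisation `e` (station (E) in w2's global form `exists_trivialisation`: `he` and the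
`Λ_𝒪`-semilinearity of `e ∘ 𝒸` on ALL of `𝐇¹`, S153) and `L⁻ ≠ 0`, station (R) restricted to the classes `z` with `𝒸 z = 0` (torsion classes, classes
invisible to the Coleman coordinates) — all `c′, w, q, μt`, every admissible `e` — is EQUIVALENT to «no tuple `(z, c′, w, q, μt)` with `𝒸 z = 0` is a
Kato valued class». By k3-g26's coordinatewise dictionary (σ1) + `CoordNondeg` + R1's transfer, `𝒸 z = 0` makes `w` VAL-invisible, and §C then
excludes it (mod (H-RIG)): the degenerate branch of the (R) port is exactly this rung. [cite: Kato2004Asterisque, Thm. 12.5 (1)–(2) (pp. 221–222)] -/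
theorem stationR_on_ker_cvec_iff [W.IsGloballyMinimal]
    (Φ : AlgebraicClosure ℚ_[2] ≃ₐ[ℚ] AlgebraicClosure (π.v.adicCompletion ℚ))
    (τ : ∀ m : ℕ, ZMod (2 ^ m) → Field.absoluteGaloisGroup ℚ_[2]) {Lm : IwasawaAlgebraO S} (hLm : Lm ≠ 0)
    (hE : ∃ e : (Fin n → PowerSeries ℤ_[2]) ≃+ IwasawaAlgebraO S,
      (∀ (r : PowerSeries ℤ_[2]) (t : Fin n → PowerSeries ℤ_[2]), e (r • t) = PowerSeries.map (padicIntToCoeffIntegers S) r * e t) ∧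
        ∀ (s : IwasawaAlgebraO S) (x : I.H), e (π.cvec (s • x)) = s * e (π.cvec x)) :
    (∀ z : I.H, π.cvec z = 0 →
        ∀ (c' : Fin n → ↥(padicCoeffIntegers S)) (w : ℕ → Fin π.nb → PadicAlgCl 2) (q : PadicAlgCl 2) (μt : IwasawaAlgebraO S),
          π.KatoValuedClass g ι Ω Φ τ z c' w q μt →
          ∀ e : (Fin n → PowerSeries ℤ_[2]) ≃+ IwasawaAlgebraO S,
            (∀ (r : PowerSeries ℤ_[2]) (t : Fin n → PowerSeries ℤ_[2]), e (r • t) = PowerSeries.map (padicIntToCoeffIntegers S) r * e t) →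
            (∀ (s : IwasawaAlgebraO S) (x : I.H), x ∈ Submodule.span (IwasawaAlgebraO S) ({z} : Set I.H) →
              e (π.cvec (s • x)) = s * e (π.cvec x)) →
            ∃ (ν : ↥(padicCoeffIntegers S)) (u : IwasawaAlgebraO S), ν ≠ 0 ∧ u ≠ 0 ∧
              PowerSeries.C ν * e (π.cvec z) = μt * (Lm * u)) ↔
      ∀ z : I.H, π.cvec z = 0 →
        ∀ (c' : Fin n → ↥(padicCoeffIntegers S)) (w : ℕ → Fin π.nb → PadicAlgCl 2) (q : PadicAlgCl 2) (μt : IwasawaAlgebraO S),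
          ¬ π.KatoValuedClass g ι Ω Φ τ z c' w q μt := by
  constructor
  · intro h z hz c' w q μt hcl
    obtain ⟨e, he, hl⟩ := hE
    exact no_relation_of_cvec_eq_zero π e hz hcl.2.1 hLm (h z hz c' w q μt hcl e he fun s x _ ↦ hl s x)
  · intro h z hz c' w q μt hcl
    exact (h z hz c' w q μt hcl).elim

/-! ## §A′ Guard audit at the zero tuple: both non-vacuity guards of child A are load-bearing on the final bytes -/

/-- **Without `μt ≠ 0` the zero tuple would be a valued class** (T64/T67 audit on the v3f bytes): at `μt = 0` all three value predicates hold
at `(z, w) = (0, 0)` for every `q`. [cite: Kato2004Asterisque, Thm. 12.5 (1) (pp. 221–222)] -/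
theorem unguarded_zero_tuple_mu [W.IsGloballyMinimal]
    (Φ : AlgebraicClosure ℚ_[2] ≃ₐ[ℚ] AlgebraicClosure (π.v.adicCompletion ℚ))
    (τ : ∀ m : ℕ, ZMod (2 ^ m) → Field.absoluteGaloisGroup ℚ_[2]) (c' : Fin n → ↥(padicCoeffIntegers S)) (q : PadicAlgCl 2) :
    π.KatoBKCoord Φ τ 0 c' 0 ∧ π.KatoValCoord g ι Ω τ 0 q 0 ∧ π.KatoTrivCoord g ι Ω τ 0 q 0 := by
  refine ⟨katoBKCoord_zero π Φ τ c', ?_, ?_⟩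
  · rw [katoValCoord_zero_iff]
    intro m ψ _ _
    simp only [map_zero, ZeroMemClass.coe_zero, zero_mul, tsum_zero, mul_zero]
  · rw [katoTrivCoord_zero_iff]
    simp only [map_zero, ZeroMemClass.coe_zero, mul_zero, zero_mul]

/-- **Without `q ≠ 0` the zero tuple would be a valued class**: at `q = 0` all three value predicates hold at `(z, w) = (0, 0)` for every
`μt`. [cite: Kato2004Asterisque, Thm. 12.5 (1) (pp. 221–222)] -/
theorem unguarded_zero_tuple_q [W.IsGloballyMinimal]
    (Φ : AlgebraicClosure ℚ_[2] ≃ₐ[ℚ] AlgebraicClosure (π.v.adicCompletion ℚ))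
    (τ : ∀ m : ℕ, ZMod (2 ^ m) → Field.absoluteGaloisGroup ℚ_[2]) (c' : Fin n → ↥(padicCoeffIntegers S)) (μt : IwasawaAlgebraO S) :
    π.KatoBKCoord Φ τ 0 c' 0 ∧ π.KatoValCoord g ι Ω τ 0 0 μt ∧ π.KatoTrivCoord g ι Ω τ 0 0 μt := by
  refine ⟨katoBKCoord_zero π Φ τ c', ?_, ?_⟩
  · rw [katoValCoord_zero_iff]
    intro m ψ _ _
    simp only [map_zero, zero_mul]
  · rw [katoTrivCoord_zero_iff]
    simp only [mul_zero, zero_mul]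

/-! ## §C₀ The EVALUATED VALUE FORMULA `S_w(ψ)·g(ψ) = q·P(ζ_ψ−1)·(μt·L)(ζ_ψ−1)` (both signs), the pointwise engine and its converse -/

/-- **(EVALUATED VALUE FORMULA, right side; PROVED, sign-agnostic, needs no (VAL)).** If `θ_N(g;Ω)^ι ≡ P · L (mod ω_N)` in `Λ_𝒪 ⊗ ℚ`
(`IsCongrModOmegaO`; for a Pollack pair `P = (−1)^{N/2+1}ω⁺_N, L = L⁺` at odd `N` and `P = (−1)^{N/2+1}ω⁻_N, L = L⁻` at even `N`) and `ψ` is an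
even primitive character mod `2^{N+2}` (`N ≥ 1`, so `ζ_ψ := ψ(5)` has exact order `2^N`), then the right-hand side of (VALρ) at `ψ` is
`q · μt(ζ_ψ − 1) · Σ_a ψ(a) ι[a/2^{N+2}]⁺ = q · P(ζ_ψ − 1) · (μt · L)(ζ_ψ − 1)` in `ℂ₂` (`eval₂_map_mazurTateElementK_eq_sum`,
`IsCongrModOmegaO.eval₂_eq_mul`, `tsum_map_coeff_mul_mul_pow`). [cite: Pollack2003, Prop. 6.9 (proof), Prop. 6.18 (proof)] -/
theorem valRHS_eq_mul_eval₂_mul_tsum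
    {L : IwasawaAlgebraO S} {N : ℕ} (hN : 1 ≤ N) {P : (PadicAlgCl 2)[X]}
    (hcong : IsCongrModOmegaO S N ((mazurTateElementK g Ω 2 N).map ι) ((P : PowerSeries (PadicAlgCl 2)) * iwasawaOToPowerSeries S L))
    (q : PadicAlgCl 2) (μt : IwasawaAlgebraO S)
    (ψ : DirichletCharacter (PadicAlgCl 2) (2 ^ (N + 2))) (hψe : ψ (-1) = 1) (hψp : ψ.IsPrimitive) :
    algebraMap (PadicAlgCl 2) ℂ_[2] q *
          (∑' k, algebraMap (PadicAlgCl 2) ℂ_[2] ((PowerSeries.coeff k μt : ↥(padicCoeffIntegers S)) : PadicAlgCl 2) *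
              (algebraMap (PadicAlgCl 2) ℂ_[2] (ψ (5 : ZMod (2 ^ (N + 2)))) - 1) ^ k) *
        algebraMap (PadicAlgCl 2) ℂ_[2] (∑ a : ZMod (2 ^ (N + 2)), ψ a * ι (plusSymbolK g Ω ((a.val : ℚ) / (2 : ℚ) ^ (N + 2)))) =
      algebraMap (PadicAlgCl 2) ℂ_[2] q *
          P.eval₂ (algebraMap (PadicAlgCl 2) ℂ_[2]) (algebraMap (PadicAlgCl 2) ℂ_[2] (ψ (5 : ZMod (2 ^ (N + 2)))) - 1) *
        ∑' k, ((algebraMap (PadicAlgCl 2) ℂ_[2]).comp (padicCoeffIntegers S).subtype) (PowerSeries.coeff k (μt * L)) *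
          (algebraMap (PadicAlgCl 2) ℂ_[2] (ψ (5 : ZMod (2 ^ (N + 2)))) - 1) ^ k := by
  classical
  have hφn : ∀ x : PadicAlgCl 2, ‖algebraMap (PadicAlgCl 2) ℂ_[2] x‖ = ‖x‖ := fun x ↦ PadicComplex.norm_extends 2 x
  have hbd : ∀ (A : IwasawaAlgebraO S) (k : ℕ),
      ‖((algebraMap (PadicAlgCl 2) ℂ_[2]).comp (padicCoeffIntegers S).subtype) (PowerSeries.coeff k A)‖ ≤ 1 := fun A k ↦ by
    rw [RingHom.comp_apply, hφn]
    exact (PowerSeries.coeff k A).2.2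
  have hζ := isPrimitiveRoot_apply_five hN ψ hψe hψp
  generalize hζdef : algebraMap (PadicAlgCl 2) ℂ_[2] (ψ (5 : ZMod (2 ^ (N + 2)))) = ζ at hζ ⊢
  have hz : ‖ζ - 1‖ < 1 := norm_sub_one_lt_one_of_pow_prime_pow_eq_one (p := 2) hζ.pow_eq_one
  have hzn : (1 + (ζ - 1)) ^ 2 ^ N = 1 := by rw [add_sub_cancel]; exact hζ.pow_eq_one
  have hev := ResidualThetaLayer.IsCongrModOmegaO.eval₂_eq_mul hcong hz hzn
  set χ : DirichletCharacter ℂ_[2] (2 ^ (N + 2)) := ψ.ringHomComp (algebraMap (PadicAlgCl 2) ℂ_[2]) with hχ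
  have hχe : χ.Even := by
    show χ (-1) = 1
    rw [hχ, MulChar.ringHomComp_apply, hψe, map_one]
  have hχ5 : χ (5 : ZMod (2 ^ (N + 2))) = ζ := by
    rw [hχ, MulChar.ringHomComp_apply, hζdef]
  have hθ : ((mazurTateElementK g Ω 2 N).map ι).eval₂ (algebraMap (PadicAlgCl 2) ℂ_[2]) (ζ - 1) =
      algebraMap (PadicAlgCl 2) ℂ_[2]
        (∑ a : ZMod (2 ^ (N + 2)), ψ a * ι (plusSymbolK g Ω ((a.val : ℚ) / (2 : ℚ) ^ (N + 2)))) := by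
    rw [← hχ5, eval₂_map_mazurTateElementK_two g ι Ω χ hχe, map_sum]
    refine Finset.sum_congr rfl fun a _ ↦ ?_
    rw [map_mul, hχ, MulChar.ringHomComp_apply]
  rw [← hθ, hev, tsum_map_coeff_mul_mul_pow ((algebraMap (PadicAlgCl 2) ℂ_[2]).comp (padicCoeffIntegers S).subtype) (hbd μt) (hbd L) hz]
  have hLsum : (∑' k, algebraMap (PadicAlgCl 2) ℂ_[2] (PowerSeries.coeff k (iwasawaOToPowerSeries S L)) * (ζ - 1) ^ k) =
      ∑' k, ((algebraMap (PadicAlgCl 2) ℂ_[2]).comp (padicCoeffIntegers S).subtype) (PowerSeries.coeff k L) * (ζ - 1) ^ k :=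
    tsum_congr fun k ↦ by rw [coeff_iwasawaOToPowerSeries]; rfl
  have hMsum : (∑' k, algebraMap (PadicAlgCl 2) ℂ_[2] ((PowerSeries.coeff k μt : ↥(padicCoeffIntegers S)) : PadicAlgCl 2) * (ζ - 1) ^ k) =
      ∑' k, ((algebraMap (PadicAlgCl 2) ℂ_[2]).comp (padicCoeffIntegers S).subtype) (PowerSeries.coeff k μt) * (ζ - 1) ^ k :=
    tsum_congr fun k ↦ rfl
  rw [hLsum, hMsum]
  ring

/-- **(VALUE FORMULA, PROVED).** Under `θ_N^ι ≡ P · L (mod ω_N)` and (VALρ) for `(w, q, μt)`: for every even primitive `ψ` mod `2^{N+2}`, `N ≥ 1`,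
`S_w(ψ) · g(ψ) = q · P(ζ_ψ − 1) · (μt · L)(ζ_ψ − 1)` in `ℂ₂`, where `S_w(ψ) = Σ_j bO_j Σ_b ψ⁻¹(b) τ_b • w_{N+2,j}` is the twisted Galois sum of the
value vector and `g(ψ)` the Gauss sum. So ON THE VALUE SIDE the only freedom a valued class has at level `N` is the finite zero set of `μt · L^{±}`.
[cite: Kato2004Asterisque, Thm. 12.5 (1) (pp. 221–222), §15.16 (p. 265)] [cite: Pollack2003, Prop. 6.18 (proof)] -/
theorem twistedSum_mul_gaussSum_eq
    {L : IwasawaAlgebraO S} {N : ℕ} (hN : 1 ≤ N) {P : (PadicAlgCl 2)[X]}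
    (hcong : IsCongrModOmegaO S N ((mazurTateElementK g Ω 2 N).map ι) ((P : PowerSeries (PadicAlgCl 2)) * iwasawaOToPowerSeries S L))
    (τ : ∀ m : ℕ, ZMod (2 ^ m) → Field.absoluteGaloisGroup ℚ_[2]) {w : ℕ → Fin π.nb → PadicAlgCl 2} {q : PadicAlgCl 2}
    {μt : IwasawaAlgebraO S} (hVAL : π.KatoValCoord g ι Ω τ w q μt)
    (ψ : DirichletCharacter (PadicAlgCl 2) (2 ^ (N + 2))) (hψe : ψ (-1) = 1) (hψp : ψ.IsPrimitive) :
    algebraMap (PadicAlgCl 2) ℂ_[2]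
        ((∑ j : Fin π.nb, ((π.bO j : ↥(padicCoeffIntegers S)) : PadicAlgCl 2) *
            ∑ b : (ZMod (2 ^ (N + 2)))ˣ, ψ⁻¹ (b : ZMod (2 ^ (N + 2))) * τ (N + 2) (b : ZMod (2 ^ (N + 2))) • w (N + 2) j) *
          gaussSum ψ (AddChar.zmodChar (2 ^ (N + 2)) (SignedKatoOffTwo.HondaLog.zeta_pow_prime_pow_self (p := 2) (N + 2)))) =
      algebraMap (PadicAlgCl 2) ℂ_[2] q *
          P.eval₂ (algebraMap (PadicAlgCl 2) ℂ_[2]) (algebraMap (PadicAlgCl 2) ℂ_[2] (ψ (5 : ZMod (2 ^ (N + 2)))) - 1) *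
        ∑' k, ((algebraMap (PadicAlgCl 2) ℂ_[2]).comp (padicCoeffIntegers S).subtype) (PowerSeries.coeff k (μt * L)) *
          (algebraMap (PadicAlgCl 2) ℂ_[2] (ψ (5 : ZMod (2 ^ (N + 2)))) - 1) ^ k :=
  (hVAL N ψ hψe hψp).trans (valRHS_eq_mul_eval₂_mul_tsum g ι Ω hN hcong q μt ψ hψe hψp)

/-- **(ENGINE, pointwise; PROVED).** Under `θ_N^ι ≡ P · L (mod ω_N)`, (VALρ) for `(w, q, μt)` with `q ≠ 0`, and `P(ζ_ψ − 1) ≠ 0`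
(`eval₂_signedOmegaMinus_ne_zero` / `eval₂_signedOmegaPlus_ne_zero` for a Pollack pair): if the twisted Galois sum of `w` at the even primitive
`ψ` mod `2^{N+2}` VANISHES, then `(μt · L)(ζ_ψ − 1) = 0`. [cite: Kato2004Asterisque, Thm. 12.5 (1) (pp. 221–222)] [cite: Pollack2003, Prop. 6.18 (proof)] -/
theorem tsum_coeff_mul_eq_zero_of_twistedSum_eq_zero
    {L : IwasawaAlgebraO S} {N : ℕ} (hN : 1 ≤ N) {P : (PadicAlgCl 2)[X]}
    (hcong : IsCongrModOmegaO S N ((mazurTateElementK g Ω 2 N).map ι) ((P : PowerSeries (PadicAlgCl 2)) * iwasawaOToPowerSeries S L))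
    (τ : ∀ m : ℕ, ZMod (2 ^ m) → Field.absoluteGaloisGroup ℚ_[2]) {w : ℕ → Fin π.nb → PadicAlgCl 2} {q : PadicAlgCl 2}
    {μt : IwasawaAlgebraO S} (hq : q ≠ 0) (hVAL : π.KatoValCoord g ι Ω τ w q μt)
    (ψ : DirichletCharacter (PadicAlgCl 2) (2 ^ (N + 2))) (hψe : ψ (-1) = 1) (hψp : ψ.IsPrimitive)
    (hP : P.eval₂ (algebraMap (PadicAlgCl 2) ℂ_[2]) (algebraMap (PadicAlgCl 2) ℂ_[2] (ψ (5 : ZMod (2 ^ (N + 2)))) - 1) ≠ 0)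
    (hS : ∑ j : Fin π.nb, ((π.bO j : ↥(padicCoeffIntegers S)) : PadicAlgCl 2) *
        ∑ b : (ZMod (2 ^ (N + 2)))ˣ, ψ⁻¹ (b : ZMod (2 ^ (N + 2))) * τ (N + 2) (b : ZMod (2 ^ (N + 2))) • w (N + 2) j = 0) :
    ∑' k, ((algebraMap (PadicAlgCl 2) ℂ_[2]).comp (padicCoeffIntegers S).subtype) (PowerSeries.coeff k (μt * L)) *
        (algebraMap (PadicAlgCl 2) ℂ_[2] (ψ (5 : ZMod (2 ^ (N + 2)))) - 1) ^ k = 0 := by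
  have hV := twistedSum_mul_gaussSum_eq g ι Ω π hN hcong τ hVAL ψ hψe hψp
  rw [hS, zero_mul, map_zero] at hV
  have hq' : algebraMap (PadicAlgCl 2) ℂ_[2] q ≠ 0 := (_root_.map_ne_zero _).mpr hq
  rcases mul_eq_zero.mp hV.symm with h | h
  · rcases mul_eq_zero.mp h with h' | h'
    · exact (hq' h').elim
    · exact (hP h').elim
  · exact h

/-- **(CONVERSE — the exact zero locus; PROVED).** Under `θ_N^ι ≡ P · L (mod ω_N)` and (VALρ): if `(μt · L)(ζ_ψ − 1) = 0` and the Gauss sum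
`g(ψ) ≠ 0`, the twisted Galois sum of `w` at `ψ` vanishes. With the engine: **`S_w(ψ) = 0 ⟺ (μt · L^{±})(ψ(5) − 1) = 0`** at every even primitive
`ψ` of conductor `2^{N+2}`, `N ≥ 1` — the VAL-visible zero locus of a valued class is EXACTLY the zero divisor of `μt · L^{±}` on the cyclotomic
points. (`g(ψ) ≠ 0` for primitive `ψ` at prime-power modulus: `g(ψ) g(ψ̄) = ψ(−1) 2^{N+2}`; the tree has it over `ℂ` as
`LargeSieve.gaussSum_mul_gaussSum_inv`, the `ℚ̄₂`-valued port is plan helper (P-GAUSS).) [cite: Kato2004Asterisque, Thm. 12.5 (1)] [cite: Washington1997, Lemma 4.8] -/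
theorem twistedSum_eq_zero_of_tsum_coeff_mul_eq_zero
    {L : IwasawaAlgebraO S} {N : ℕ} (hN : 1 ≤ N) {P : (PadicAlgCl 2)[X]}
    (hcong : IsCongrModOmegaO S N ((mazurTateElementK g Ω 2 N).map ι) ((P : PowerSeries (PadicAlgCl 2)) * iwasawaOToPowerSeries S L))
    (τ : ∀ m : ℕ, ZMod (2 ^ m) → Field.absoluteGaloisGroup ℚ_[2]) {w : ℕ → Fin π.nb → PadicAlgCl 2} {q : PadicAlgCl 2}
    {μt : IwasawaAlgebraO S} (hVAL : π.KatoValCoord g ι Ω τ w q μt)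
    (ψ : DirichletCharacter (PadicAlgCl 2) (2 ^ (N + 2))) (hψe : ψ (-1) = 1) (hψp : ψ.IsPrimitive)
    (hg : gaussSum ψ (AddChar.zmodChar (2 ^ (N + 2)) (SignedKatoOffTwo.HondaLog.zeta_pow_prime_pow_self (p := 2) (N + 2))) ≠ 0)
    (hT : ∑' k, ((algebraMap (PadicAlgCl 2) ℂ_[2]).comp (padicCoeffIntegers S).subtype) (PowerSeries.coeff k (μt * L)) *
        (algebraMap (PadicAlgCl 2) ℂ_[2] (ψ (5 : ZMod (2 ^ (N + 2)))) - 1) ^ k = 0) :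
    ∑ j : Fin π.nb, ((π.bO j : ↥(padicCoeffIntegers S)) : PadicAlgCl 2) *
        ∑ b : (ZMod (2 ^ (N + 2)))ˣ, ψ⁻¹ (b : ZMod (2 ^ (N + 2))) * τ (N + 2) (b : ZMod (2 ^ (N + 2))) • w (N + 2) j = 0 := by
  have hV := twistedSum_mul_gaussSum_eq g ι Ω π hN hcong τ hVAL ψ hψe hψp
  rw [hT, mul_zero, map_eq_zero_iff _ (algebraMap (PadicAlgCl 2) ℂ_[2]).injective] at hV
  exact (mul_eq_zero.mp hV).resolve_right hg

/-! ## §C (R₀) — Pollack rigidity: a VAL-invisible value vector (in particular `w = 0`) is never part of a valued class -/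

set_option maxHeartbeats 1600000 in
/-- **(R₀⁺) Pollack rigidity (PROVED from two cyclotomic helpers).** With `L⁻ ≠ 0` and the EVEN half of a Pollack pair for `(g, ι, Ω)`
(`θ_N ≡ (−1)^{N/2+1} ω⁻_N L⁻ (mod ω_N)` in `Λ_𝒪 ⊗ ℚ`, `N` even — `IsPollackPairK g ι Ω Lp Lm` `.2.2.2` / `.2.1` when `S = range ι`), NO tuple
`(z, c′, w, q, μt)` whose value vector `w` is VAL-INVISIBLE at the even levels (all twisted Galois sums `Σ_j bO_j Σ_b ψ⁻¹(b) τ_b • w_{m+2,j}`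
vanish for `m` even, `ψ` even primitive) is a Kato valued class — in particular none with `w = 0`, none with Galois-fixed values. Helpers:
(H-CHAR) every primitive `2^N`-th root of unity in `ℂ₂` (`N ≥ 1`) is `ψ(5)` for an even primitive `ℚ̄₂`-valued `ψ` mod `2^{N+2}` — PROVED
above (`exists_even_primitive_apply_five_eq`); (H-RIG, displayed as a hypothesis) an element of `Λ_𝒪` vanishing at `ζ − 1` for all primitive
`ζ` of order `2^{ℓ_i+1}` along an unbounded family `ℓ_i` is `0` (k3-g25 `eq_zero_of_forall_primitive_tsum_eq_zero`, Weierstrass division). MECHANISM: VAL at `ψ_ζ` gives `μt(ζ−1) · Λ_g(ψ_ζ) = 0`; the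
even congruence evaluated (`IsCongrModOmegaO.eval₂_eq_mul`, `eval₂_map_mazurTateElementK_eq_sum`) gives `Λ_g(ψ_ζ) = ±ω⁻_N(ζ−1) L⁻(ζ−1)`
with `ω⁻_N(ζ−1) ≠ 0`; so `(μt · L⁻)(ζ−1) = 0` at all primitive `ζ` of order `2^N`, `N` even; rigidity gives `μt · L⁻ = 0`: absurd.
[cite: Pollack2003, Cor. 5.11, Prop. 6.18 (proof)] [cite: Kato2004Asterisque, Thm. 12.5 (1) (pp. 221–222)] [cite: Washington1997, §7.1 Prop. 7.2, Thm. 7.3] -/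
theorem not_katoValuedClass_of_valInvisible [W.IsGloballyMinimal]
    {Lm : IwasawaAlgebraO S} (hLm : Lm ≠ 0)
    (hcong : ∀ N : ℕ, Even N →
      IsCongrModOmegaO S N ((mazurTateElementK g Ω 2 N).map ι)
        (((((-1 : ℤ[X]) ^ (N / 2 + 1) * cyclotomicOmegaMinus 2 N).map (Int.castRingHom (PadicAlgCl 2)) : (PadicAlgCl 2)[X]) :
            PowerSeries (PadicAlgCl 2)) * iwasawaOToPowerSeries S Lm))
    (hRIG : ∀ (G : IwasawaAlgebraO S) (ℓ : ℕ → ℕ), (∀ m : ℕ, ∃ i, m < ℓ i) →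
      (∀ (i : ℕ) (ζ : ℂ_[2]), IsPrimitiveRoot ζ (2 ^ (ℓ i + 1)) →
        ∑' k, ((algebraMap (PadicAlgCl 2) ℂ_[2]).comp (padicCoeffIntegers S).subtype) (PowerSeries.coeff k G) * (ζ - 1) ^ k = 0) →
      G = 0)
    (Φ : AlgebraicClosure ℚ_[2] ≃ₐ[ℚ] AlgebraicClosure (π.v.adicCompletion ℚ))
    (τ : ∀ m : ℕ, ZMod (2 ^ m) → Field.absoluteGaloisGroup ℚ_[2]) (z : I.H) (c' : Fin n → ↥(padicCoeffIntegers S))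
    (w : ℕ → Fin π.nb → PadicAlgCl 2) (q : PadicAlgCl 2) (μt : IwasawaAlgebraO S)
    (hw : ∀ (m : ℕ) (ψ : DirichletCharacter (PadicAlgCl 2) (2 ^ (m + 2))), ψ (-1) = 1 → ψ.IsPrimitive → Even m →
      ∑ j : Fin π.nb, ((π.bO j : ↥(padicCoeffIntegers S)) : PadicAlgCl 2) *
          ∑ b : (ZMod (2 ^ (m + 2)))ˣ, ψ⁻¹ (b : ZMod (2 ^ (m + 2))) * τ (m + 2) (b : ZMod (2 ^ (m + 2))) • w (m + 2) j = 0) :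
    ¬ π.KatoValuedClass g ι Ω Φ τ z c' w q μt := by
  rintro ⟨hq, hμ, -, -, hVAL, -⟩
  -- the product `μt · L⁻` vanishes at every `ζ − 1`, `ζ` of exact order `2^{2i+2}`: (H-CHAR) supplies `ψ` with `ψ(5) = ζ`, the ENGINE does the rest
  have key : μt * Lm = 0 := by
    refine hRIG (μt * Lm) (fun i ↦ 2 * i + 1) (fun m ↦ ⟨m, by omega⟩) fun i ζ hζ ↦ ?_
    have hN : 2 * i + 1 + 1 = 2 * i + 2 := by ring
    rw [hN] at hζ
    obtain ⟨ψ, hψe, hψp, hψ5⟩ := exists_even_primitive_apply_five_eq (2 * i + 2) ζ (by omega) hζ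
    have h := tsum_coeff_mul_eq_zero_of_twistedSum_eq_zero g ι Ω π (N := 2 * i + 2) (by omega) (hcong (2 * i + 2) ⟨i + 1, by ring⟩)
      τ hq hVAL ψ hψe hψp (by rw [hψ5]; exact eval₂_signedOmegaMinus_ne_zero (N := 2 * i + 2) ⟨i + 1, by ring⟩ hζ)
      (hw (2 * i + 2) ψ hψe hψp ⟨i + 1, by ring⟩)
    rwa [hψ5] at h
  rcases mul_eq_zero.mp key with h0 | h0
  · exact hμ h0
  · exact hLm h0

/-- **(R₀) the case `w = 0`** (any `z`): the zero value vector is never part of a Kato valued class. [cite: Pollack2003, Cor. 5.11, Prop. 6.18 (proof)]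
[cite: Kato2004Asterisque, Thm. 12.5 (1) (pp. 221–222)] -/
theorem not_katoValuedClass_w_zero [W.IsGloballyMinimal]
    {Lm : IwasawaAlgebraO S} (hLm : Lm ≠ 0)
    (hcong : ∀ N : ℕ, Even N →
      IsCongrModOmegaO S N ((mazurTateElementK g Ω 2 N).map ι)
        (((((-1 : ℤ[X]) ^ (N / 2 + 1) * cyclotomicOmegaMinus 2 N).map (Int.castRingHom (PadicAlgCl 2)) : (PadicAlgCl 2)[X]) :
            PowerSeries (PadicAlgCl 2)) * iwasawaOToPowerSeries S Lm))
    (hRIG : ∀ (G : IwasawaAlgebraO S) (ℓ : ℕ → ℕ), (∀ m : ℕ, ∃ i, m < ℓ i) →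
      (∀ (i : ℕ) (ζ : ℂ_[2]), IsPrimitiveRoot ζ (2 ^ (ℓ i + 1)) →
        ∑' k, ((algebraMap (PadicAlgCl 2) ℂ_[2]).comp (padicCoeffIntegers S).subtype) (PowerSeries.coeff k G) * (ζ - 1) ^ k = 0) →
      G = 0)
    (Φ : AlgebraicClosure ℚ_[2] ≃ₐ[ℚ] AlgebraicClosure (π.v.adicCompletion ℚ))
    (τ : ∀ m : ℕ, ZMod (2 ^ m) → Field.absoluteGaloisGroup ℚ_[2]) (z : I.H) (c' : Fin n → ↥(padicCoeffIntegers S))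
    (q : PadicAlgCl 2) (μt : IwasawaAlgebraO S) :
    ¬ π.KatoValuedClass g ι Ω Φ τ z c' 0 q μt :=
  not_katoValuedClass_of_valInvisible g ι Ω π hLm hcong hRIG Φ τ z c' 0 q μt fun m ψ _ _ _ ↦ by
    simp only [Pi.zero_apply, smul_zero, mul_zero, Finset.sum_const_zero]

/-- **Contrapositive: the value vector of a Kato valued class is WILD** — some twisted Galois sum at an even level is nonzero (what station (R)'s
`ν ≠ 0` will need on the value side). [cite: Kato2004Asterisque, Thm. 12.5 (1) (pp. 221–222)] [cite: Pollack2003, Cor. 5.11] -/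
theorem exists_twistedSum_ne_zero_of_katoValuedClass [W.IsGloballyMinimal]
    {Lm : IwasawaAlgebraO S} (hLm : Lm ≠ 0)
    (hcong : ∀ N : ℕ, Even N →
      IsCongrModOmegaO S N ((mazurTateElementK g Ω 2 N).map ι)
        (((((-1 : ℤ[X]) ^ (N / 2 + 1) * cyclotomicOmegaMinus 2 N).map (Int.castRingHom (PadicAlgCl 2)) : (PadicAlgCl 2)[X]) :
            PowerSeries (PadicAlgCl 2)) * iwasawaOToPowerSeries S Lm))
    (hRIG : ∀ (G : IwasawaAlgebraO S) (ℓ : ℕ → ℕ), (∀ m : ℕ, ∃ i, m < ℓ i) →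
      (∀ (i : ℕ) (ζ : ℂ_[2]), IsPrimitiveRoot ζ (2 ^ (ℓ i + 1)) →
        ∑' k, ((algebraMap (PadicAlgCl 2) ℂ_[2]).comp (padicCoeffIntegers S).subtype) (PowerSeries.coeff k G) * (ζ - 1) ^ k = 0) →
      G = 0)
    {Φ : AlgebraicClosure ℚ_[2] ≃ₐ[ℚ] AlgebraicClosure (π.v.adicCompletion ℚ)}
    {τ : ∀ m : ℕ, ZMod (2 ^ m) → Field.absoluteGaloisGroup ℚ_[2]} {z : I.H} {c' : Fin n → ↥(padicCoeffIntegers S)}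
    {w : ℕ → Fin π.nb → PadicAlgCl 2} {q : PadicAlgCl 2} {μt : IwasawaAlgebraO S}
    (hcl : π.KatoValuedClass g ι Ω Φ τ z c' w q μt) :
    ∃ (m : ℕ) (ψ : DirichletCharacter (PadicAlgCl 2) (2 ^ (m + 2))), ψ (-1) = 1 ∧ ψ.IsPrimitive ∧ Even m ∧
      ∑ j : Fin π.nb, ((π.bO j : ↥(padicCoeffIntegers S)) : PadicAlgCl 2) *
          ∑ b : (ZMod (2 ^ (m + 2)))ˣ, ψ⁻¹ (b : ZMod (2 ^ (m + 2))) * τ (m + 2) (b : ZMod (2 ^ (m + 2))) • w (m + 2) j ≠ 0 := by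
  by_contra h
  refine not_katoValuedClass_of_valInvisible g ι Ω π hLm hcong hRIG Φ τ z c' w q μt (fun m ψ h1 h2 h3 ↦ ?_) hcl
  by_contra h'
  exact h ⟨m, ψ, h1, h2, h3, h'⟩

/-- **Corollary: station (R) holds on the whole slice `w = 0`** (vacuously — its guard is never met there), for every `e`, under the
hypotheses of `not_katoValuedClass_of_valInvisible`. [cite: Kato2004Asterisque, Thm. 12.5 (1)–(2) (pp. 221–222)] [cite: Pollack2003, Cor. 5.11] -/
theorem stationR_at_w_zero [W.IsGloballyMinimal]
    {Lm : IwasawaAlgebraO S} (hLm : Lm ≠ 0)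
    (hcong : ∀ N : ℕ, Even N →
      IsCongrModOmegaO S N ((mazurTateElementK g Ω 2 N).map ι)
        (((((-1 : ℤ[X]) ^ (N / 2 + 1) * cyclotomicOmegaMinus 2 N).map (Int.castRingHom (PadicAlgCl 2)) : (PadicAlgCl 2)[X]) :
            PowerSeries (PadicAlgCl 2)) * iwasawaOToPowerSeries S Lm))
    (hRIG : ∀ (G : IwasawaAlgebraO S) (ℓ : ℕ → ℕ), (∀ m : ℕ, ∃ i, m < ℓ i) →
      (∀ (i : ℕ) (ζ : ℂ_[2]), IsPrimitiveRoot ζ (2 ^ (ℓ i + 1)) →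
        ∑' k, ((algebraMap (PadicAlgCl 2) ℂ_[2]).comp (padicCoeffIntegers S).subtype) (PowerSeries.coeff k G) * (ζ - 1) ^ k = 0) →
      G = 0)
    (Φ : AlgebraicClosure ℚ_[2] ≃ₐ[ℚ] AlgebraicClosure (π.v.adicCompletion ℚ))
    (τ : ∀ m : ℕ, ZMod (2 ^ m) → Field.absoluteGaloisGroup ℚ_[2]) (z : I.H) (c' : Fin n → ↥(padicCoeffIntegers S))
    (q : PadicAlgCl 2) (μt : IwasawaAlgebraO S) (hcl : π.KatoValuedClass g ι Ω Φ τ z c' 0 q μt)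
    (e : (Fin n → PowerSeries ℤ_[2]) ≃+ IwasawaAlgebraO S) :
    ∃ (ν : ↥(padicCoeffIntegers S)) (u : IwasawaAlgebraO S), ν ≠ 0 ∧ u ≠ 0 ∧ PowerSeries.C ν * e (π.cvec z) = μt * (Lm * u) :=
  (not_katoValuedClass_w_zero g ι Ω π hLm hcong hRIG Φ τ z c' q μt hcl).elim

/-! ## §D The v3f currency: `S := range ι`, the hypotheses read off the Pollack-pair BINDER of RSL_g (`IsPollackPairK g ι Ω Lp Lm`) -/

/-- **(R₀) in the one-pair bundle's own currency (S138 in kernel).** On `S = range ι`, with the binder `IsPollackPairK g ι Ω Lp Lm` of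
RSL_g's text (`.2.1 : L⁻ ≠ 0`, `.2.2.2` = the even congruences) and the rigidity lemma (H-RIG) of the evaluation road, NO tuple with value
vector `w = 0` is a Kato valued class of child A — for ANY class `z` and ANY multiplier `μt`; in particular k1-g25 F3's junk tuple
`(0, c′, 0, 1, T)` is excluded by (VALρ) + the binder, exactly as S138 words it. [cite: Kato2004Asterisque, Thm. 12.5 (1) (pp. 221–222)]
[cite: Pollack2003, Cor. 5.11, Prop. 6.18 (proof)] -/
theorem not_katoValuedClass_w_zero_of_isPollackPairK [W.IsGloballyMinimal]
    {ρ₁ : FramedGaloisRep ℚ ↥(padicCoeffIntegers (Set.range ι)) 2}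
    {Θ₁ : ∀ v : HeightOneSpectrum (𝓞 ℚ), ((2 : ℕ) : 𝓞 ℚ) ∈ v.asIdeal →
      (Cofree ρ₁ ↥(padicCoeffField (Set.range ι)) ≃+ (Fin n → ↥(W.geomPrimaryTorsion 2)))}
    {hΘ₁ : ∀ v hv (δ : absoluteGaloisGroup (v.adicCompletion ℚ)) m i,
      Θ₁ v hv (resGalOfEmb (closureEmb (K := ℚ) (v.adicCompletion ℚ)) δ • m) i =
        resGalOfEmb (closureEmb (K := ℚ) (v.adicCompletion ℚ)) δ • Θ₁ v hv m i}
    {I₁ : Kato2004.IwasawaH1DataCoeff (FramedGaloisRep.toGaloisRep ρ₁) 2 κ γ}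
    {Sg₁ : AddSubgroup (subgroupH1 κ.kerSubgroup (Cofree ρ₁ ↥(padicCoeffField (Set.range ι))))}
    [Module ↥(padicCoeffIntegers (Set.range ι)) ↥Sg₁]
    (π₁ : OnePairPins (Set.range ι) W κ γ S₀ n ρ₁ Θ₁ hΘ₁ I₁ Sg₁)
    {Lp Lm : IwasawaAlgebraO (Set.range ι)} (hL : IsPollackPairK g ι Ω Lp Lm)
    (hRIG : ∀ (G : IwasawaAlgebraO (Set.range ι)) (ℓ : ℕ → ℕ), (∀ m : ℕ, ∃ i, m < ℓ i) →
      (∀ (i : ℕ) (ζ : ℂ_[2]), IsPrimitiveRoot ζ (2 ^ (ℓ i + 1)) →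
        ∑' k, ((algebraMap (PadicAlgCl 2) ℂ_[2]).comp (padicCoeffIntegers (Set.range ι)).subtype) (PowerSeries.coeff k G) *
          (ζ - 1) ^ k = 0) → G = 0)
    (Φ : AlgebraicClosure ℚ_[2] ≃ₐ[ℚ] AlgebraicClosure (π₁.v.adicCompletion ℚ))
    (τ : ∀ m : ℕ, ZMod (2 ^ m) → Field.absoluteGaloisGroup ℚ_[2]) (z : I₁.H) (c' : Fin n → ↥(padicCoeffIntegers (Set.range ι)))
    (q : PadicAlgCl 2) (μt : IwasawaAlgebraO (Set.range ι)) :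
    ¬ π₁.KatoValuedClass g ι Ω Φ τ z c' 0 q μt :=
  not_katoValuedClass_w_zero g ι Ω π₁ hL.2.1 (fun N hN ↦ hL.2.2.2 N hN) hRIG Φ τ z c' q μt

/-- **Station (R) on the slice `w = 0`, in the v3f currency** (vacuous: the guard is never met). [cite: Kato2004Asterisque, Thm. 12.5 (1)–(2)] -/
theorem stationR_at_w_zero_of_isPollackPairK [W.IsGloballyMinimal]
    {ρ₁ : FramedGaloisRep ℚ ↥(padicCoeffIntegers (Set.range ι)) 2}
    {Θ₁ : ∀ v : HeightOneSpectrum (𝓞 ℚ), ((2 : ℕ) : 𝓞 ℚ) ∈ v.asIdeal →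
      (Cofree ρ₁ ↥(padicCoeffField (Set.range ι)) ≃+ (Fin n → ↥(W.geomPrimaryTorsion 2)))}
    {hΘ₁ : ∀ v hv (δ : absoluteGaloisGroup (v.adicCompletion ℚ)) m i,
      Θ₁ v hv (resGalOfEmb (closureEmb (K := ℚ) (v.adicCompletion ℚ)) δ • m) i =
        resGalOfEmb (closureEmb (K := ℚ) (v.adicCompletion ℚ)) δ • Θ₁ v hv m i}
    {I₁ : Kato2004.IwasawaH1DataCoeff (FramedGaloisRep.toGaloisRep ρ₁) 2 κ γ}
    {Sg₁ : AddSubgroup (subgroupH1 κ.kerSubgroup (Cofree ρ₁ ↥(padicCoeffField (Set.range ι))))}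
    [Module ↥(padicCoeffIntegers (Set.range ι)) ↥Sg₁]
    (π₁ : OnePairPins (Set.range ι) W κ γ S₀ n ρ₁ Θ₁ hΘ₁ I₁ Sg₁)
    {Lp Lm : IwasawaAlgebraO (Set.range ι)} (hL : IsPollackPairK g ι Ω Lp Lm)
    (hRIG : ∀ (G : IwasawaAlgebraO (Set.range ι)) (ℓ : ℕ → ℕ), (∀ m : ℕ, ∃ i, m < ℓ i) →
      (∀ (i : ℕ) (ζ : ℂ_[2]), IsPrimitiveRoot ζ (2 ^ (ℓ i + 1)) →
        ∑' k, ((algebraMap (PadicAlgCl 2) ℂ_[2]).comp (padicCoeffIntegers (Set.range ι)).subtype) (PowerSeries.coeff k G) *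
          (ζ - 1) ^ k = 0) → G = 0)
    (Φ : AlgebraicClosure ℚ_[2] ≃ₐ[ℚ] AlgebraicClosure (π₁.v.adicCompletion ℚ))
    (τ : ∀ m : ℕ, ZMod (2 ^ m) → Field.absoluteGaloisGroup ℚ_[2]) (z : I₁.H) (c' : Fin n → ↥(padicCoeffIntegers (Set.range ι)))
    (q : PadicAlgCl 2) (μt : IwasawaAlgebraO (Set.range ι)) (hcl : π₁.KatoValuedClass g ι Ω Φ τ z c' 0 q μt)
    (e : (Fin n → PowerSeries ℤ_[2]) ≃+ IwasawaAlgebraO (Set.range ι)) :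
    ∃ (ν : ↥(padicCoeffIntegers (Set.range ι))) (u : IwasawaAlgebraO (Set.range ι)), ν ≠ 0 ∧ u ≠ 0 ∧
      PowerSeries.C ν * e (π₁.cvec z) = μt * (Lm * u) :=
  (not_katoValuedClass_w_zero_of_isPollackPairK g ι Ω π₁ hL hRIG Φ τ z c' q μt hcl).elim

/-! ## §E Quantitative wildness: `(H-FIN) ⟹ (H-RIG)` and «a Kato valued class is VAL-visible at EVERY large level» (odd levels via `L⁺`, even via `L⁻`) -/

/-- **(H-FIN) ⟹ (H-RIG) (PROVED).** Finiteness of the cyclotomic zeros of a nonzero element of `Λ_𝒪` — displayed here in the «eventually along the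
levels» form (H-FIN): `G ≠ 0 ⟹ ∃ N₀ ∀ N ≥ N₀ ∀ ζ of exact order 2^N, G(ζ − 1) ≠ 0` (Weierstrass preparation over `𝒪⟦T⟧`; the tree has the
`ℤ_p`-pattern `MemIwasawaRat.finite_setOf_hasSum_zero`, the `𝒪`-port is plan helper (H-FIN)) — implies the rigidity hypothesis (H-RIG) of §C
(primitive `2^m`-th roots exist in `ℚ̄₂ ⊂ ℂ₂`: `PadicCyclotomicTower.isPrimitiveRoot_zeta`). So every §C/§D statement holds under (H-FIN) alone.
[cite: Washington1997, §7.1 Thm. 7.3, Prop. 7.2] -/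
theorem hRIG_of_hFIN
    (hFIN : ∀ G : IwasawaAlgebraO S, G ≠ 0 → ∃ N₀ : ℕ, ∀ N : ℕ, N₀ ≤ N → ∀ ζ : ℂ_[2], IsPrimitiveRoot ζ (2 ^ N) →
      ∑' k, ((algebraMap (PadicAlgCl 2) ℂ_[2]).comp (padicCoeffIntegers S).subtype) (PowerSeries.coeff k G) * (ζ - 1) ^ k ≠ 0) :
    ∀ (G : IwasawaAlgebraO S) (ℓ : ℕ → ℕ), (∀ m : ℕ, ∃ i, m < ℓ i) →
      (∀ (i : ℕ) (ζ : ℂ_[2]), IsPrimitiveRoot ζ (2 ^ (ℓ i + 1)) →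
        ∑' k, ((algebraMap (PadicAlgCl 2) ℂ_[2]).comp (padicCoeffIntegers S).subtype) (PowerSeries.coeff k G) * (ζ - 1) ^ k = 0) →
      G = 0 := by
  intro G ℓ hℓ h
  by_contra hG
  obtain ⟨N₀, hN₀⟩ := hFIN G hG
  obtain ⟨i, hi⟩ := hℓ N₀
  have hζ : IsPrimitiveRoot (algebraMap (PadicAlgCl 2) ℂ_[2] (PadicCyclotomicTower.zeta 2 (ℓ i + 1))) (2 ^ (ℓ i + 1)) :=
    (PadicCyclotomicTower.isPrimitiveRoot_zeta 2 (ℓ i + 1)).map_of_injective (algebraMap (PadicAlgCl 2) ℂ_[2]).injective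
  exact hN₀ (ℓ i + 1) (by omega) _ hζ (h i _ hζ)

/-- **A KATO VALUED CLASS IS VAL-VISIBLE AT EVERY LARGE LEVEL (PROVED mod (H-FIN)).** With a full signed pair — `L⁺ ≠ 0`, `L⁻ ≠ 0`, the odd
congruences `θ_N ≡ ±ω⁺_N L⁺` and the even ones `θ_N ≡ ±ω⁻_N L⁻ (mod ω_N)` (= the four components of RSL_g's binder `IsPollackPairK g ι Ω Lp Lm`) —
and (H-FIN), the value vector `w` of any Kato valued class `(z, c′, w, q, μt)` has NON-VANISHING twisted Galois sum `S_w(ψ) ≠ 0` at EVERY even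
primitive `ψ` of conductor `2^{N+2}` for all `N ≥ N₀(μt, L⁺, L⁻)` — odd AND even `N`. This is the quantitative form of §C's wildness and exactly
the value-side input «`w_σ(ψ_ζ) ≠ 0` for `m ≥ m₀`» that the (R) supplier's unit step (w3 g18 F3) and `stub_kzgValueRelation`'s `ν ≠ 0` consume.
[cite: Kato2004Asterisque, Thm. 12.5 (1) (pp. 221–222)] [cite: Pollack2003, Cor. 5.11, Prop. 6.18 (proof)] [cite: Washington1997, §7.1 Thm. 7.3] -/
theorem eventually_twistedSum_ne_zero_of_katoValuedClass [W.IsGloballyMinimal]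
    {Lp Lm : IwasawaAlgebraO S} (hLp : Lp ≠ 0) (hLm : Lm ≠ 0)
    (hcongOdd : ∀ N : ℕ, Odd N →
      IsCongrModOmegaO S N ((mazurTateElementK g Ω 2 N).map ι)
        (((((-1 : ℤ[X]) ^ (N / 2 + 1) * cyclotomicOmegaPlus 2 N).map (Int.castRingHom (PadicAlgCl 2)) : (PadicAlgCl 2)[X]) :
            PowerSeries (PadicAlgCl 2)) * iwasawaOToPowerSeries S Lp))
    (hcongEven : ∀ N : ℕ, Even N →
      IsCongrModOmegaO S N ((mazurTateElementK g Ω 2 N).map ι)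
        (((((-1 : ℤ[X]) ^ (N / 2 + 1) * cyclotomicOmegaMinus 2 N).map (Int.castRingHom (PadicAlgCl 2)) : (PadicAlgCl 2)[X]) :
            PowerSeries (PadicAlgCl 2)) * iwasawaOToPowerSeries S Lm))
    (hFIN : ∀ G : IwasawaAlgebraO S, G ≠ 0 → ∃ N₀ : ℕ, ∀ N : ℕ, N₀ ≤ N → ∀ ζ : ℂ_[2], IsPrimitiveRoot ζ (2 ^ N) →
      ∑' k, ((algebraMap (PadicAlgCl 2) ℂ_[2]).comp (padicCoeffIntegers S).subtype) (PowerSeries.coeff k G) * (ζ - 1) ^ k ≠ 0)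
    {Φ : AlgebraicClosure ℚ_[2] ≃ₐ[ℚ] AlgebraicClosure (π.v.adicCompletion ℚ)}
    {τ : ∀ m : ℕ, ZMod (2 ^ m) → Field.absoluteGaloisGroup ℚ_[2]} {z : I.H} {c' : Fin n → ↥(padicCoeffIntegers S)}
    {w : ℕ → Fin π.nb → PadicAlgCl 2} {q : PadicAlgCl 2} {μt : IwasawaAlgebraO S}
    (hcl : π.KatoValuedClass g ι Ω Φ τ z c' w q μt) :
    ∃ N₀ : ℕ, ∀ N : ℕ, N₀ ≤ N → ∀ ψ : DirichletCharacter (PadicAlgCl 2) (2 ^ (N + 2)), ψ (-1) = 1 → ψ.IsPrimitive →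
      ∑ j : Fin π.nb, ((π.bO j : ↥(padicCoeffIntegers S)) : PadicAlgCl 2) *
          ∑ b : (ZMod (2 ^ (N + 2)))ˣ, ψ⁻¹ (b : ZMod (2 ^ (N + 2))) * τ (N + 2) (b : ZMod (2 ^ (N + 2))) • w (N + 2) j ≠ 0 := by
  obtain ⟨hq, hμ, -, -, hVAL, -⟩ := hcl
  obtain ⟨Np, hNp⟩ := hFIN (μt * Lp) (mul_ne_zero hμ hLp)
  obtain ⟨Nm, hNm⟩ := hFIN (μt * Lm) (mul_ne_zero hμ hLm)
  refine ⟨Np + Nm + 1, fun N hN ψ hψe hψp hS ↦ ?_⟩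
  have hN1 : 1 ≤ N := by omega
  have hζ := isPrimitiveRoot_apply_five hN1 ψ hψe hψp
  rcases Nat.even_or_odd N with hNe | hNo
  · exact hNm N (by omega) _ hζ
      (tsum_coeff_mul_eq_zero_of_twistedSum_eq_zero g ι Ω π hN1 (hcongEven N hNe) τ hq hVAL ψ hψe hψp
        (eval₂_signedOmegaMinus_ne_zero hNe hζ) hS)
  · exact hNp N (by omega) _ hζ
      (tsum_coeff_mul_eq_zero_of_twistedSum_eq_zero g ι Ω π hN1 (hcongOdd N hNo) τ hq hVAL ψ hψe hψp
        (eval₂_signedOmegaPlus_ne_zero hNo hζ) hS)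

/-- **The same in the v3f currency** (`S = range ι`; all four hypotheses read off RSL_g's binder `IsPollackPairK g ι Ω Lp Lm`): modulo (H-FIN),
the value vector of a Kato valued class of child A is VAL-visible at every level `N ≥ N₀`. [cite: Pollack2003, Cor. 5.11, Prop. 6.18]
[cite: Kato2004Asterisque, Thm. 12.5 (1) (pp. 221–222)] -/
theorem eventually_twistedSum_ne_zero_of_isPollackPairK [W.IsGloballyMinimal]
    {ρ₁ : FramedGaloisRep ℚ ↥(padicCoeffIntegers (Set.range ι)) 2}
    {Θ₁ : ∀ v : HeightOneSpectrum (𝓞 ℚ), ((2 : ℕ) : 𝓞 ℚ) ∈ v.asIdeal →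
      (Cofree ρ₁ ↥(padicCoeffField (Set.range ι)) ≃+ (Fin n → ↥(W.geomPrimaryTorsion 2)))}
    {hΘ₁ : ∀ v hv (δ : absoluteGaloisGroup (v.adicCompletion ℚ)) m i,
      Θ₁ v hv (resGalOfEmb (closureEmb (K := ℚ) (v.adicCompletion ℚ)) δ • m) i =
        resGalOfEmb (closureEmb (K := ℚ) (v.adicCompletion ℚ)) δ • Θ₁ v hv m i}
    {I₁ : Kato2004.IwasawaH1DataCoeff (FramedGaloisRep.toGaloisRep ρ₁) 2 κ γ}
    {Sg₁ : AddSubgroup (subgroupH1 κ.kerSubgroup (Cofree ρ₁ ↥(padicCoeffField (Set.range ι))))}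
    [Module ↥(padicCoeffIntegers (Set.range ι)) ↥Sg₁]
    (π₁ : OnePairPins (Set.range ι) W κ γ S₀ n ρ₁ Θ₁ hΘ₁ I₁ Sg₁)
    {Lp Lm : IwasawaAlgebraO (Set.range ι)} (hL : IsPollackPairK g ι Ω Lp Lm)
    (hFIN : ∀ G : IwasawaAlgebraO (Set.range ι), G ≠ 0 → ∃ N₀ : ℕ, ∀ N : ℕ, N₀ ≤ N → ∀ ζ : ℂ_[2], IsPrimitiveRoot ζ (2 ^ N) →
      ∑' k, ((algebraMap (PadicAlgCl 2) ℂ_[2]).comp (padicCoeffIntegers (Set.range ι)).subtype) (PowerSeries.coeff k G) *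
        (ζ - 1) ^ k ≠ 0)
    {Φ : AlgebraicClosure ℚ_[2] ≃ₐ[ℚ] AlgebraicClosure (π₁.v.adicCompletion ℚ)}
    {τ : ∀ m : ℕ, ZMod (2 ^ m) → Field.absoluteGaloisGroup ℚ_[2]} {z : I₁.H} {c' : Fin n → ↥(padicCoeffIntegers (Set.range ι))}
    {w : ℕ → Fin π₁.nb → PadicAlgCl 2} {q : PadicAlgCl 2} {μt : IwasawaAlgebraO (Set.range ι)}
    (hcl : π₁.KatoValuedClass g ι Ω Φ τ z c' w q μt) :
    ∃ N₀ : ℕ, ∀ N : ℕ, N₀ ≤ N → ∀ ψ : DirichletCharacter (PadicAlgCl 2) (2 ^ (N + 2)), ψ (-1) = 1 → ψ.IsPrimitive →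
      ∑ j : Fin π₁.nb, ((π₁.bO j : ↥(padicCoeffIntegers (Set.range ι))) : PadicAlgCl 2) *
          ∑ b : (ZMod (2 ^ (N + 2)))ˣ, ψ⁻¹ (b : ZMod (2 ^ (N + 2))) * τ (N + 2) (b : ZMod (2 ^ (N + 2))) • w (N + 2) j ≠ 0 :=
  eventually_twistedSum_ne_zero_of_katoValuedClass g ι Ω π₁ hL.1 hL.2.1 (fun N hN ↦ hL.2.2.1 N hN) (fun N hN ↦ hL.2.2.2 N hN) hFIN hcl

end Summit.BirchSwinnertonDyer.BirchSwinnertonDyer.Cruxes.ResidualThetaCountLowerPureAtTwo.SideaK4G26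

end
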